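import Mathlib.Probability.Moments.Basic
import Literature.MathematicalPhysics.QuantumFieldTheory.Balaban1983to89.B1Eq343FluctuationChi
import Literature.MathematicalPhysics.QuantumFieldTheory.Balaban1983to89.HiggsCondGauss228
import Literature.MathematicalPhysics.QuantumFieldTheory.Balaban1983to89.B2LargeField
import Literature.MathematicalPhysics.QuantumFieldTheory.Balaban1983to89.B1Ineq353Proof

/-!
# `Balaban1983to89.B1Eq324SmallFieldLeaf` — T. Bałaban, *(Higgs)₂,₃ quantum fields in a finite volume. I. A lower bound*,
Commun. Math. Phys. **85** (1982) 603–626 [Balaban1982Higgs1], (3.24) p. 616 and (3.59) p. 623: **THE SMALL-FIELD LEAF OF THE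
CUMULANT EXPANSION — `|log⟨χ⟩| ≤ O(ε^κ)|T₁|` — PROVED FOR THE CONCRETE FLUCTUATION MEASURES OF THE TREE**, i.e. the first of the
three named inputs ((a) `|log⟨χ⟩| ≤ C₁ε^κ|T₁|`, (b) cumulants of the unweighted vs the `χ`-weighted law, (c) the remainder bound of
"the lemma on p. 152 of [2]") from which p27's `B1Eq324CumulantTaylor.eq324_chi` derives the display (3.24)
`⟨χ exp V⟩ = exp[Σ_{n≤n̄} (1/n!)⟨Vⁿ⟩ᵀ + O(ε^κ)|T₁|]`; theorems + four definitions with bodies (two test fields, two variances); no `Prop`-valued fact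

statement-level skeleton of published theorems with citation tags; proofs where landed; nothing here is a claim about the Yang–Mills mass gap

PDF held: `paper:balaban1982-cmp85-higgs23-i` (journal page = PDF page + 602); pp. 614, 616, 617, 623 [PDF 12, 14, 15, 21] re-read this
session in the materialised text `~/.lit/texts/paper-balaban1982-cmp85-higgs23-i/p0012|p0014|p0015|p0021.txt` (the quotations below
were checked against it; p. 617 also on the ×2 render `run/shared/lean/pub/pub-balaban/b2b-balaban-ref1/pages/1982-cmp85-higgs23-I/…-p015-x2.png`).

CITATION HEADER (lean-in-tree rule).  lit-balaban typed skeleton (HOME `run/shared/lean/pub/lit-balaban/`), unit `lit-balaban-r14`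
gen 24 (B1 fold owner `literature-prover-lit-balaban-r14-g24-0`; TAKING line HOME/STATUS.md 2026-08-24T16:05:51Z, free-target protocol
G.5-34 (d); v1 = p382558 ✓ e00b231bd4ec; v1.1 = + §6–§9, same seat).  SKELETON rows **B1.Eq3.24** / **B1.Eq3.59** (rows of record r12 `lit-balaban-r12/ROWS-B1-part2.md`, both `typed`;
r12's status cell: *"DISCHARGED MODULO NAMED LEAVES p244819 … the lemma of [2] (Benfatto et al. CMP 59) itself is external"*) —
this file RETIRES LEAF (a) on the carrier; it claims no head change (leaves (b), (c) = the content of the lemma of [2], whose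
source is NOT HELD, acquisition ids acq-09340 / acq-07983).  USED BY NAME, NOTHING RESTATED: the typer's Gaussian probability
measure `HiggsFluctMeasure.fluctMeasure` (= `dμ_{C^{(k)}}(A′)`) with its moment generating function
`HiggsFluctMeasureCov.integral_exp_siteInner_fluctMeasure`, the typer's conditional Gaussian measure `HiggsCondGauss228.condGauss`
(= `dμ_{C^{(k)}_Λ(Ω,A)}(φ′)`, the scalar factor of (3.24)/(3.56)) with `HiggsCondGauss228.integral_exp_siteInner_condGauss`, r14's
cut-offs `B1Eq343FluctuationChi.chiFluct` / `chiFluctA` ((3.12)/(3.43)) / `chiFluctφ` ((3.20)/(3.50)), Mathlib's Chernoff bound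
`ProbabilityTheory.measure_ge_le_exp_mul_mgf`.

THE SOURCE TEXT (verbatim).  p. 616: *"we would like to have a cumulant expansion formula in the form taking into account the
existence of the characteristic functions also ⟨χ exp(V)⟩ = exp[⟨V⟩ + (1/2!)⟨V²⟩^T + … + (1/n̄!)⟨V^{n̄}⟩^T + O(ε^κ)|T₁|], κ > d. (3.24)
There is one obvious way of proving this formula, namely by a cluster expansion, but it is a long and tedious way. Instead we will
rely on the results of Benfatto et al. [2]. The lemma formulated on p. 152 of this paper can be applied in our situation because all
the assumptions are satisfied."*; here `⟨·⟩` is *"the expectation value with respect to the measure dμ_{C⁽⁰⁾}(A′)dμ_{C⁽⁰⁾(B⁽¹⁾)}(φ′)"*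
(p. 616 after (3.23)) and `χ = χ(A′)χ(φ′)` are the characteristic functions (3.12) p. 614 *"|A′(x)| ≦ p₁(ε) … p₁(ε) =
b₁(1 + log ε^{−1})^{p₁}"* and (3.20) p. 615; at the general step (3.59) p. 623 *"… exp[Σ_{n=1}^{n̄} (1/n!)⟨(V^{(k)})ⁿ⟩^T +
O(1)(L^kε)^κ|T₁^{(k)}|], κ > d"* with `χ(A′)`, `χ(φ′)` of (3.43)/(3.50) (threshold `p₁(L^kε)`).  What the leaf needs of print's data:
the fields under `⟨·⟩` are centred Gaussian (p. 617: *"The fields A′_j … are independent Gaussian random variables with the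
covariances C^{(j),L^jε}"*) with a bounded covariance (Prop. 2.3 (2.33) p. 611), and `p₁(ε)` grows faster than
`(log ε^{−1})^{1/2}` (`p₁` is print's exponent; B2 p. 557 takes the analogous exponents `> 2`).

WHAT IS PROVED (0 `sorry`, standard axioms).
§1 GENERIC, for any probability measure `μ`:
  * `one_sub_integral_chiFluct_le` — UNION BOUND for a product cut-off `Π_x χ({|F(x)| ≦ t})` (r14's `chiFluct`):
    `1 − ∫χ dμ ≤ Σ_x μ{t < |F(x)|}`, and `integral_chiFluct_le_one`, `integral_chiFluct_eq_measureReal`;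
  * `abs_log_le_two_mul` — the logarithm step: `1 − u ≤ y ≤ 1`, `u ≤ ½` ⇒ `|log y| ≤ 2u`;
  * `measureReal_ge_le_of_mgf` / `measureReal_le_neg_le_of_mgf` / `measureReal_abs_gt_le_of_mgf` — CHERNOFF FROM A GAUSSIAN
    MOMENT GENERATING FUNCTION: `∫e^{sX}dμ = e^{s²c/2}` for all `s`, `c ≤ σ²`, `0 < σ²` ⇒ `μ{p < |X|} ≤ 2e^{−p²/(2σ²)}` (`p ≥ 0`);
  * `measureReal_norm_gt_le_sum` — for a random vector in `ℝⁿ`, `μ{t < ‖V‖} ≤ Σᵢ μ{t/√n < |Vᵢ|}` (`t ≥ 0`; private helper: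
    `t < ‖v‖` forces `t/√n < |vᵢ|` for some `i`).
§2 THE VECTOR FLUCTUATION FIELD, `μ = dμ_{C^{(j),L^jε}}` (`fluctMeasure P μ₀² a j`; `μ₀² > 0`, `a > 0`, `L > 1`, `j ≤ K`), `χ(A′) =
  chiFluctA t A′`: the test fields `bondDelta b` (value `(L^jε)^{−d}` on the bond `b`, so that `⟨toSite A′, toSite(bondDelta b)⟩_{(1.5)} =
  A′_b`, `siteInner_bondDelta`), the variances `bondVar … b := ⟨toSite(bondDelta b), C^{(j)} toSite(bondDelta b)⟩` (= the diagonal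
  kernel of `C^{(j),L^jε}` in the pairing (1.5)), the m.g.f. of each bond variable `integral_exp_mul_apply_fluctMeasure`
  (`∫e^{sA′_b}dμ = e^{s²·bondVar b/2}`, from the typer's identity BY NAME), the one-bond tail `measureReal_abs_apply_gt_le`, the one-site
  tail `measureReal_norm_toSite_gt_le` (`μ{t < |A′(x)|} ≤ 2d·e^{−t²/(2dσ²)}`), and
  **`one_sub_integral_chiFluctA_le`** (`⟨χ(A′)⟩ ≥ 1 − 2d|T^{(j)}|e^{−t²/(2dσ²)}`) and **`abs_log_integral_chiFluctA_le`**
  (`|log⟨χ(A′)⟩| ≤ 4d|T^{(j)}|e^{−t²/(2dσ²)}` once `2d|T^{(j)}|e^{−t²/(2dσ²)} ≤ ½`), under the ONE displayed hypothesis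
  `hσ : ∀ b, bondVar b ≤ σ²` (a uniform bound on the diagonal of the covariance — the Prop. 2.3-type input, NOT proved here).
§3 THE SCALAR FLUCTUATION FIELD, `μ = dμ_{C^{(k)}_Λ(Ω,A)}` (`condGauss C Ω A m² a k Λ`; `m² > 0`, `a > 0`, `L > 1`, `k ≤ K`, in the
  coordinates of the tree, field `fieldOfCrd Λ x`), `χ(φ′) = chiFluctφ t (fieldOfCrd Λ x)`: test fields `siteDelta y i`, variances
  `siteVar … y i := ⟨siteDelta y i, C^{(k)}_Λ(Ω,A) siteDelta y i⟩`, `integral_exp_mul_apply_condGauss`, and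
  **`one_sub_integral_chiFluctφ_le`** / **`abs_log_integral_chiFluctφ_le`** (`N ≥ 1` components; constants `2N|T^{(k)}|e^{−t²/(2Nσ²)}`).
§4 `abs_log_integral_chi_prod_le` — BOTH FACTORS: for the product measure `dμ_{C^{(k)}}(A′)dμ_{C^{(k)}_Λ(Ω,B)}(φ′)` of (3.24)/(3.59)
  (`⟨χ(A′)χ(φ′)⟩ = ⟨χ(A′)⟩⟨χ(φ′)⟩`, r14's `B1Eq356FluctuationIntegral.integral356C_zero`), `|log| ≤ 2τ_A + 2τ_φ`; and
  `abs_log_le_of_tail_le_pow` / `…_le_pow` — THE HYPOTHESIS SHAPE of p27's `B1Eq324CumulantTaylor.eq324_chi` (`|log(∫χ dμ)| ≤ C₁·s^κ·vol`).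
§5 THE PRINTED THRESHOLD `t = p₁(s) = b₁(1 + log s⁻¹)^{p₁}` ((3.12) p. 614; `B2.pFn`), `b₁ > 0`, `p₁ > ½`: `exp_neg_pFn_sq_le_pow`
  (`e^{−p₁(s)²/(2nσ²)} ≤ s^K` for `s ≤ s₁(K)`, BY NAME from p12's `B2LargeField.expPSqSmall` = II p. 557 *"exp(−c₀p(ε)²) is smaller
  than the arbitrary power ε^K"*) and **`abs_log_integral_chiFluctA_printed`** / **`abs_log_integral_chiFluctφ_printed`**: for every
  `K`, for `0 < s ≤ s₁` with `2d|T|s^K ≤ ½` (resp. `2N|T|s^K ≤ ½`), `|log⟨χ⟩| ≤ 4d|T|·s^K` (resp. `4N|T|·s^K`) — print's `O(ε^κ)|T₁|`,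
  `κ` arbitrary (print: `κ > d`, which is what makes `ε^κ|T₁| = O(ε^{κ−d})` small; here the smallness is the explicit hypothesis);
  this is print's threshold read on the UNIT lattice (r14's `B1Eq343FluctuationChi.chiFluctA_printed`).
§6 (v1.1) THE SAME IN THE TREE'S `ε`-UNITS: threshold `(L^kε)^{−(d−2)/2}p₁(L^kε)` (`B1Eq31Concrete.thrF`, the (1.22) rescaling),
  variance bound of the matching size `σ₁²(L^kε)^{−(d−2)}`; the exponent is scale free (`thrF_sq_div`: `t²/(2nσ²) = p₁²/(2nσ₁²)`),
  whence **`abs_log_integral_chiFluctA_thrF`** / **`abs_log_integral_chiFluctφ_thrF`**: `|log⟨χ⟩| ≤ 4d|T|(L^kε)^K` given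
  `e^{−p₁(L^kε)²/(2dσ₁²)} ≤ (L^kε)^K` (`exp_neg_pFn_sq_le_pow`) and `2d|T|(L^kε)^K ≤ ½`.
§7 (v1.1) `integral_chiFluctA_pos` / `integral_chiFluctφ_pos` / `integral_chi_prod_pos` — `⟨χ⟩ ≥ ½ > 0` once the tail `≤ ½`: the
  hypothesis `hpos` of p27's `eq324_chi` (field `χ_pos` of `B1Eq324CumulantTaylor.Realization`).
§8 (v1.1) `siteInner_fluctCov_self_le` (a coercive operator has a form-bounded inverse: `c‖f‖² ≤ ⟨f,(C^{(j)})⁻¹f⟩ ⇒ ⟨g,C^{(j)}g⟩ ≤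
  c⁻¹‖g‖²`) and **`bondVar_le_of_ineq233_lower(')`**: the displayed input `hσ` of §2/§6 FOLLOWS, with `σ₁² = γ₀⁻¹`, from print's
  Prop. 2.3 (2.33) LOWER HALF in the tree's level form `γ₀(L^jε)^{−2}‖f‖² ≤ ⟨f,(a(L^{j+1}ε)^{−2}P + Δ^{(j)})f⟩` (the vector-field
  covariance; (2.33) itself stays an input — its lower half is [B4]-content, not in this file).
§9 (v1.1) `siteInner_condCov232_self_le` + **`siteVar_le_of_ineq233_lower(')`** — THE SAME FOR THE SCALAR CONDITIONAL COVARIANCE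
  (2.32): the (2.33) lower half for `a(L^{k+1}ε)^{−2}P(A) + Δ^{(k)}(Ω,A)` (general `A`, `Ω`) gives `siteVar y i ≤ γ₀⁻¹(L^kε)^{−(d−2)}`
  for EVERY conditioning set `Λ` (p. 611, Prop. 2.3: constants *"independent of Λ, k, Ω and A"*), via the typer's `((…)↾_Λ)·C^{(k)}_Λ = Λ`
  (`HiggsCondCov232.restrictOp_precOpA_condCov232_apply`).
  (For THE integral (3.56) WITH BODY at `V^{(k)} = 0`, r14's `B1Eq356FluctuationIntegral.integral356C_zero` rewrites it as
  `⟨χ(A′)⟩⟨χ(φ′)⟩`, to which §4/§7 apply; not imported here to keep this file's build cone small.)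
HONEST SCOPE.  (i) The union bound replaces print's (unstated) argument; the constants `2`, `4`, `2d`, `2N` are ours and immaterial.
(ii) The covariance-diagonal bound `σ²` is a HYPOTHESIS (`hσ`); §8/§9 derive it (vector / scalar field) from the (2.33) lower half `γ₀I ≤ …`,
which is Prop. 2.3 content (the tree's `B1Prop23…` / `B1Ineq233…` / `B1Ineq225…` files treat such bounds on sub-families); (2.33)
itself is not derived or claimed here.
(iii) The product measure of (3.24) factorises (`⟨χ(A′)χ(φ′)⟩ = ⟨χ(A′)⟩⟨χ(φ′)⟩`, `log` additive), so the two halves are stated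
separately; (3.59)'s measure `dμ_{C^{(k)}}(A′)dμ_{C^{(k)}(B^{(k+1)})}(φ′)` is §2 at level `k` times §3 at `Λ = T^{(k)}`.  (iv) Leaves
(b), (c) of (3.24)/(3.59) — the lemma of [2] — are NOT touched; rows B1.Eq3.24/3.59 keep their heads.  NOT summit progress; NOT Clay.
-/

open scoped BigOperators InnerProductSpace
open _root_.MeasureTheory _root_.ProbabilityTheory

namespace Literature.MathematicalPhysics.QuantumFieldTheory.Balaban1983to89.B1Eq324SmallFieldLeaf

open HiggsLattice HiggsAveraging HiggsCovariance HiggsFluctMeasure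
open B3MultiscaleFields (toSite)
open B1Eq31Concrete (ind)
open B1Eq343FluctuationChi (chiFluct chiFluct_eq_ite chiFluct_nonneg chiFluct_le_one chiFluctA chiFluctφ)
open HiggsFluctMeasurePos (siteInner_comm siteInner_add_right siteInner_smul_right siteInner_smul_left toSite_smul
  fluctMeasure_isProbability)
open HiggsFluctMeasureCov (siteInner_toSite_toSite integral_exp_siteInner_fluctMeasure)
open HiggsCondGauss228 (condGauss fieldOfCrd inSet isProbabilityMeasure_condGauss integral_exp_siteInner_condGauss
  siteInner_fieldOfCrd)
open HiggsCondCov232 (condCov232)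
open B2Eq228Conditioning (In resIn)

noncomputable section

/-! ## §1 Generic: union bound, the logarithm step, Chernoff from a Gaussian m.g.f., norm versus components -/

section Generic

variable {Ω : Type*} [MeasurableSpace Ω] (μ : Measure Ω)

/-- The product cut-off is the indicator of *"the restriction holds at every site"*: `∫ Π_x χ({|F(x)| ≦ t}) dμ = μ{∀ x, |F(x)| ≦ t}`.
[cite: Balaban1982Higgs1, (3.24) p.616] -/
theorem integral_chiFluct_eq_measureReal {X : Type} [Fintype X] (t : ℝ) {F : Ω → X → ℝ}
    (hF : ∀ x, Measurable fun ω => F ω x) :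
    ∫ ω, chiFluct t (F ω) ∂μ = μ.real {ω | ∀ x, F ω x ≤ t} := by
  have hS : MeasurableSet {ω | ∀ x, F ω x ≤ t} := by
    have : {ω | ∀ x, F ω x ≤ t} = ⋂ x, {ω | F ω x ≤ t} := by
      ext ω; simp
    rw [this]
    exact MeasurableSet.iInter fun x => measurableSet_le (hF x) measurable_const
  rw [← integral_indicator_one hS]
  refine integral_congr_ae (Filter.Eventually.of_forall fun ω => ?_)
  show chiFluct t (F ω) = Set.indicator {ω | ∀ x, F ω x ≤ t} 1 ω
  rw [chiFluct_eq_ite]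
  by_cases h : ∀ x, F ω x ≤ t
  · rw [if_pos h, Set.indicator_of_mem (show ω ∈ {ω | ∀ x, F ω x ≤ t} from h)]
    rfl
  · rw [if_neg h, Set.indicator_of_notMem (show ω ∉ {ω | ∀ x, F ω x ≤ t} from h)]

/-- `∫ Π_x χ(…) dμ ≤ 1` on a probability measure. [cite: Balaban1982Higgs1, (3.24) p.616] -/
theorem integral_chiFluct_le_one [IsProbabilityMeasure μ] {X : Type} [Fintype X] (t : ℝ) (F : Ω → X → ℝ) :
    ∫ ω, chiFluct t (F ω) ∂μ ≤ 1 := by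
  have h := integral_mono_of_nonneg (μ := μ) (f := fun ω => chiFluct t (F ω)) (g := fun _ => (1 : ℝ))
    (Filter.Eventually.of_forall fun ω => chiFluct_nonneg t (F ω)) (integrable_const 1)
    (Filter.Eventually.of_forall fun ω => chiFluct_le_one t (F ω))
  simpa using h

/-- **UNION BOUND for the product cut-off**: `1 − ∫ Π_x χ({|F(x)| ≦ t}) dμ ≤ Σ_x μ{t < |F(x)|}` (the complement of *"small
at every site"* is the union over the sites of *"large at x"*). [cite: Balaban1982Higgs1, (3.24) p.616] -/
theorem one_sub_integral_chiFluct_le [IsProbabilityMeasure μ] {X : Type} [Fintype X] (t : ℝ) {F : Ω → X → ℝ}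
    (hF : ∀ x, Measurable fun ω => F ω x) :
    1 - ∫ ω, chiFluct t (F ω) ∂μ ≤ ∑ x, μ.real {ω | t < F ω x} := by
  have hS : MeasurableSet {ω | ∀ x, F ω x ≤ t} := by
    have : {ω | ∀ x, F ω x ≤ t} = ⋂ x, {ω | F ω x ≤ t} := by
      ext ω; simp
    rw [this]
    exact MeasurableSet.iInter fun x => measurableSet_le (hF x) measurable_const
  rw [integral_chiFluct_eq_measureReal μ t hF, ← probReal_compl_eq_one_sub hS]
  have hsub : {ω | ∀ x, F ω x ≤ t}ᶜ ⊆ ⋃ x, {ω | t < F ω x} := by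
    intro ω hω
    simp only [Set.mem_compl_iff, Set.mem_setOf_eq, not_forall, not_le] at hω
    obtain ⟨x, hx⟩ := hω
    exact Set.mem_iUnion.mpr ⟨x, hx⟩
  exact (measureReal_mono hsub).trans (measureReal_iUnion_fintype_le _)

/-- **THE LOGARITHM STEP**: if `1 − u ≤ y ≤ 1` with `0 ≤ u ≤ ½` then `|log y| ≤ 2u` (`log y ≥ 1 − 1/y ≥ −u/(1−u) ≥ −2u`).
[cite: Balaban1982Higgs1, (3.24) p.616] -/
theorem abs_log_le_two_mul {y u : ℝ} (hu0 : 0 ≤ u) (hu : u ≤ 1 / 2) (hy1 : y ≤ 1) (hy : 1 - u ≤ y) :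
    |Real.log y| ≤ 2 * u := by
  have hy0 : 0 < y := lt_of_lt_of_le (by linarith) hy
  have hlog0 : Real.log y ≤ 0 := Real.log_nonpos hy0.le hy1
  rw [abs_of_nonpos hlog0]
  have h1 : 1 - y⁻¹ ≤ Real.log y := Real.one_sub_inv_le_log_of_pos hy0
  have h1u : 0 < 1 - u := by linarith
  have h2 : y⁻¹ ≤ (1 - u)⁻¹ := by
    rw [inv_le_inv₀ hy0 h1u]
    exact hy
  have h3 : (1 - u)⁻¹ ≤ 1 + 2 * u := by
    rw [inv_le_iff_one_le_mul₀ h1u]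
    nlinarith
  linarith

variable {μ}

/-- **CHERNOFF FROM A GAUSSIAN M.G.F., upper tail**: if `∫e^{sX}dμ = e^{s²c/2}` for every real `s` with `c ≤ σ²`, `0 < σ²`, then
`μ{p ≤ X} ≤ e^{−p²/(2σ²)}` for `p ≥ 0` (Mathlib's `measure_ge_le_exp_mul_mgf` at the parameter `s = p/σ²`). [cite: Balaban1982Higgs1, (3.24) p.616] -/
theorem measureReal_ge_le_of_mgf [IsProbabilityMeasure μ] {X : Ω → ℝ} {c σsq : ℝ} (hσ : 0 < σsq) (hc : c ≤ σsq)
    (hmgf : ∀ s : ℝ, ∫ ω, Real.exp (s * X ω) ∂μ = Real.exp (s ^ 2 * c / 2)) {p : ℝ} (hp : 0 ≤ p) :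
    μ.real {ω | p ≤ X ω} ≤ Real.exp (-(p ^ 2 / (2 * σsq))) := by
  set s : ℝ := p / σsq with hs
  have hs0 : 0 ≤ s := div_nonneg hp hσ.le
  have hint : Integrable (fun ω => Real.exp (s * X ω)) μ := by
    refine Integrable.of_integral_ne_zero ?_
    rw [hmgf s]
    exact (Real.exp_pos _).ne'
  have h := measure_ge_le_exp_mul_mgf (μ := μ) (X := X) p hs0 hint
  have hmgf' : mgf X μ s = Real.exp (s ^ 2 * c / 2) := hmgf s
  rw [hmgf', ← Real.exp_add] at h
  refine h.trans (Real.exp_le_exp.mpr ?_)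
  have h1 : s ^ 2 * c / 2 ≤ s ^ 2 * σsq / 2 := by
    have := mul_le_mul_of_nonneg_left hc (sq_nonneg s)
    linarith
  have h2 : -s * p + s ^ 2 * σsq / 2 = -(p ^ 2 / (2 * σsq)) := by
    rw [hs]
    field_simp
    ring
  linarith

/-- **Lower tail**: under the same m.g.f. identity, `μ{X ≤ −p} ≤ e^{−p²/(2σ²)}` (the upper tail of `−X`). [cite: Balaban1982Higgs1, (3.24) p.616] -/
theorem measureReal_le_neg_le_of_mgf [IsProbabilityMeasure μ] {X : Ω → ℝ} {c σsq : ℝ} (hσ : 0 < σsq) (hc : c ≤ σsq)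
    (hmgf : ∀ s : ℝ, ∫ ω, Real.exp (s * X ω) ∂μ = Real.exp (s ^ 2 * c / 2)) {p : ℝ} (hp : 0 ≤ p) :
    μ.real {ω | X ω ≤ -p} ≤ Real.exp (-(p ^ 2 / (2 * σsq))) := by
  have hmgf' : ∀ s : ℝ, ∫ ω, Real.exp (s * (-X ω)) ∂μ = Real.exp (s ^ 2 * c / 2) := by
    intro s
    have h := hmgf (-s)
    simp only [neg_mul] at h
    rw [neg_sq] at h
    simpa only [mul_neg] using h
  have h := measureReal_ge_le_of_mgf (X := fun ω => -X ω) hσ hc hmgf' hp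
  have hset : {ω | X ω ≤ -p} = {ω | p ≤ -X ω} := by
    ext ω
    simp only [Set.mem_setOf_eq]
    constructor <;> intro h' <;> linarith
  rw [hset]
  exact h

/-- **Two-sided tail**: `μ{p < |X|} ≤ 2e^{−p²/(2σ²)}` (`p ≥ 0`). [cite: Balaban1982Higgs1, (3.24) p.616] -/
theorem measureReal_abs_gt_le_of_mgf [IsProbabilityMeasure μ] {X : Ω → ℝ} {c σsq : ℝ} (hσ : 0 < σsq) (hc : c ≤ σsq)
    (hmgf : ∀ s : ℝ, ∫ ω, Real.exp (s * X ω) ∂μ = Real.exp (s ^ 2 * c / 2)) {p : ℝ} (hp : 0 ≤ p) :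
    μ.real {ω | p < |X ω|} ≤ 2 * Real.exp (-(p ^ 2 / (2 * σsq))) := by
  have hsub : {ω | p < |X ω|} ⊆ {ω | p ≤ X ω} ∪ {ω | X ω ≤ -p} := by
    intro ω hω
    simp only [Set.mem_setOf_eq] at hω
    rcases le_or_gt 0 (X ω) with h | h
    · left
      rw [abs_of_nonneg h] at hω
      exact hω.le
    · right
      rw [abs_of_neg h] at hω
      show X ω ≤ -p
      linarith
  calc μ.real {ω | p < |X ω|} ≤ μ.real ({ω | p ≤ X ω} ∪ {ω | X ω ≤ -p}) := measureReal_mono hsub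
    _ ≤ μ.real {ω | p ≤ X ω} + μ.real {ω | X ω ≤ -p} := measureReal_union_le _ _
    _ ≤ Real.exp (-(p ^ 2 / (2 * σsq))) + Real.exp (-(p ^ 2 / (2 * σsq))) :=
        add_le_add (measureReal_ge_le_of_mgf hσ hc hmgf hp) (measureReal_le_neg_le_of_mgf hσ hc hmgf hp)
    _ = 2 * Real.exp (-(p ^ 2 / (2 * σsq))) := by ring

/-- **Norm versus components in `ℝⁿ`**: if every component satisfies `|vᵢ| ≤ t/√n` then `‖v‖ ≤ t` (`t ≥ 0`). [folklore] -/
private theorem norm_le_of_forall_component_le {n : ℕ} {t : ℝ} (ht : 0 ≤ t) (v : EuclideanSpace ℝ (Fin n))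
    (h : ∀ i, |v i| ≤ t / Real.sqrt n) : ‖v‖ ≤ t := by
  rcases Nat.eq_zero_or_pos n with hn | hn
  · subst hn
    rw [EuclideanSpace.norm_eq]
    simp [ht]
  have hsq : ‖v‖ ^ 2 ≤ t ^ 2 := by
    rw [EuclideanSpace.real_norm_sq_eq]
    have hn' : (0 : ℝ) < n := by exact_mod_cast hn
    have hsqrt : Real.sqrt n ^ 2 = n := Real.sq_sqrt hn'.le
    calc ∑ i, v i ^ 2 ≤ ∑ _i : Fin n, (t / Real.sqrt n) ^ 2 := by
          refine Finset.sum_le_sum fun i _ => ?_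
          have h1 := h i
          have h2 : 0 ≤ t / Real.sqrt n := le_trans (abs_nonneg _) h1
          calc v i ^ 2 = |v i| ^ 2 := (sq_abs _).symm
            _ ≤ (t / Real.sqrt n) ^ 2 := pow_le_pow_left₀ (abs_nonneg _) h1 2
      _ = n * (t / Real.sqrt n) ^ 2 := by rw [Finset.sum_const, Finset.card_univ, Fintype.card_fin, nsmul_eq_mul]
      _ = t ^ 2 := by rw [div_pow, hsqrt]; field_simp
  exact (pow_le_pow_iff_left₀ (norm_nonneg v) ht two_ne_zero).mp hsq

/-- Contrapositive: `t < ‖v‖` forces `t/√n < |vᵢ|` for some component `i` (`t ≥ 0`). [folklore] -/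
private theorem exists_component_gt_of_norm_gt {n : ℕ} {t : ℝ} (ht : 0 ≤ t) {v : EuclideanSpace ℝ (Fin n)} (h : t < ‖v‖) :
    ∃ i, t / Real.sqrt n < |v i| := by
  by_contra hc
  simp only [not_exists, not_lt] at hc
  exact absurd (norm_le_of_forall_component_le ht v hc) (not_le.mpr h)

/-- **One site from its components**: for a random vector `V : Ω → ℝⁿ` with measurable components,
`μ{t < ‖V‖} ≤ Σᵢ μ{t/√n < |Vᵢ|}` (`t ≥ 0`). [cite: Balaban1982Higgs1, (3.24) p.616] -/
theorem measureReal_norm_gt_le_sum [IsProbabilityMeasure μ] {n : ℕ} {t : ℝ} (ht : 0 ≤ t) (V : Ω → EuclideanSpace ℝ (Fin n)) :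
    μ.real {ω | t < ‖V ω‖} ≤ ∑ i, μ.real {ω | t / Real.sqrt n < |V ω i|} := by
  have hsub : {ω | t < ‖V ω‖} ⊆ ⋃ i, {ω | t / Real.sqrt n < |V ω i|} := by
    intro ω hω
    obtain ⟨i, hi⟩ := exists_component_gt_of_norm_gt ht hω
    exact Set.mem_iUnion.mpr ⟨i, hi⟩
  exact (measureReal_mono hsub).trans (measureReal_iUnion_fintype_le _)

/-- **THE PRINTED SHAPE OF LEAF (a)**: if `1 − ⟨χ⟩` is bounded by a tail total `τ ≤ C·s^κ·vol` with `τ ≤ ½` and `⟨χ⟩ ≤ 1`, then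
`|log⟨χ⟩| ≤ (2C)·s^κ·vol` — the hypothesis `ha` of p27's `B1Eq324CumulantTaylor.eq324_chi` with `C₁ = 2C`.
[cite: Balaban1982Higgs1, (3.24) p.616] -/
theorem abs_log_le_of_tail_le_pow {y τ C s κ vol : ℝ} (hy1 : y ≤ 1) (hy : 1 - τ ≤ y) (hτ0 : 0 ≤ τ) (hτ : τ ≤ 1 / 2)
    (hC : τ ≤ C * s ^ κ * vol) : |Real.log y| ≤ (2 * C) * s ^ κ * vol := by
  have h := abs_log_le_two_mul hτ0 hτ hy1 hy
  calc |Real.log y| ≤ 2 * τ := h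
    _ ≤ 2 * (C * s ^ κ * vol) := by linarith
    _ = (2 * C) * s ^ κ * vol := by ring

end Generic

/-! ## §2 The vector fluctuation field: `χ(A′)` of (3.12)/(3.43) under `dμ_{C^{(j),L^jε}}` -/

section Vector

variable {P : HiggsLattice.Params} {j : ℕ}

open Classical in
/-- The test field dual to the bond variable `A′_b` in the pairing (1.5): value `(L^jε)^{−d}` on `b`, `0` elsewhere.
[cite: Balaban1982Higgs1, (1.5) p.604] -/
def bondDelta (b : HiggsLattice.PBond P j) : HiggsLattice.VecField P j :=
  fun b' => if b' = b then (P.mesh j ^ P.d)⁻¹ else 0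

/-- `⟨toSite A′, toSite(bondDelta b)⟩_{(1.5)} = A′_b`. [cite: Balaban1982Higgs1, (1.5) p.604] -/
theorem siteInner_bondDelta (A : HiggsLattice.VecField P j) (b : HiggsLattice.PBond P j) :
    siteInner (toSite A) (toSite (bondDelta b)) = A b := by
  have hη : P.mesh j ^ P.d ≠ 0 := (pow_pos (P.mesh_pos j) _).ne'
  rw [siteInner_toSite_toSite, Finset.sum_eq_single b]
  · simp only [bondDelta, if_true]
    field_simp
  · intro b' _ hb'
    simp only [bondDelta, if_neg hb', mul_zero]
  · intro hb
    exact absurd (Finset.mem_univ b) hb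

variable (P) in
/-- **The variance of the bond variable `A′_b` under `dμ_{C^{(j),L^jε}}`**: `⟨toSite(bondDelta b), C^{(j)} toSite(bondDelta b)⟩_{(1.5)}`
— the diagonal of the covariance kernel in the pairing (1.5) (Prop. 2.3 (2.33) bounds it uniformly; here it is a number that the
consumer bounds). [cite: Balaban1982Higgs1, (2.33) p.611] -/
def bondVar (msq a : ℝ) (j : ℕ) (b : HiggsLattice.PBond P j) : ℝ :=
  siteInner (toSite (bondDelta b)) (fluctCov P msq a j (toSite (bondDelta b)))

/-- **The m.g.f. of one bond variable**: `∫ e^{sA′_b} dμ_{C^{(j)}}(A′) = e^{s²·bondVar b/2}` — the typer's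
`integral_exp_siteInner_fluctMeasure` at the test field `s·bondDelta b` (`μ₀² > 0`, `a > 0`, `L > 1`, `j ≤ K`). [cite: Balaban1982Higgs1, (2.30) p.611] -/
theorem integral_exp_mul_apply_fluctMeasure {msq a : ℝ} (hmsq : 0 < msq) (ha : 0 < a) (hL : 1 < (P.L : ℝ)) (hj : j ≤ P.K)
    (b : HiggsLattice.PBond P j) (s : ℝ) :
    ∫ A, Real.exp (s * A b) ∂(fluctMeasure P msq a j) = Real.exp (s ^ 2 * bondVar P msq a j b / 2) := by
  have h := integral_exp_siteInner_fluctMeasure (P := P) hmsq ha hL hj (s • bondDelta b)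
  have h1 : ∀ A : HiggsLattice.VecField P j, siteInner (toSite A) (toSite (s • bondDelta b)) = s * A b := fun A => by
    rw [toSite_smul, siteInner_smul_right, siteInner_bondDelta]
  simp_rw [h1] at h
  rw [h]
  congr 1
  rw [toSite_smul, map_smul, siteInner_smul_left, siteInner_smul_right, bondVar]
  ring

/-- **One-bond tail**: `μ{p < |A′_b|} ≤ 2e^{−p²/(2σ²)}` whenever `bondVar b ≤ σ²` (`0 < σ²`, `p ≥ 0`). [cite: Balaban1982Higgs1, (3.24) p.616] -/
theorem measureReal_abs_apply_gt_le {msq a : ℝ} (hmsq : 0 < msq) (ha : 0 < a) (hL : 1 < (P.L : ℝ)) (hj : j ≤ P.K)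
    {σsq : ℝ} (hσ0 : 0 < σsq) (b : HiggsLattice.PBond P j) (hσ : bondVar P msq a j b ≤ σsq) {p : ℝ} (hp : 0 ≤ p) :
    (fluctMeasure P msq a j).real {A | p < |A b|} ≤ 2 * Real.exp (-(p ^ 2 / (2 * σsq))) := by
  haveI := fluctMeasure_isProbability (P := P) hmsq ha hL hj
  exact measureReal_abs_gt_le_of_mgf hσ0 hσ (integral_exp_mul_apply_fluctMeasure hmsq ha hL hj b) hp

/-- **One-site tail for the `ℝ^d`-valued variable `A′(x) = (A′_{⟨x,μ⟩})_μ`**: `μ{t < |A′(x)|} ≤ 2d·e^{−t²/(2dσ²)}` under the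
uniform variance bound (`t ≥ 0`). [cite: Balaban1982Higgs1, (3.12) p.614] -/
theorem measureReal_norm_toSite_gt_le {msq a : ℝ} (hmsq : 0 < msq) (ha : 0 < a) (hL : 1 < (P.L : ℝ)) (hj : j ≤ P.K)
    {σsq : ℝ} (hσ0 : 0 < σsq) (hσ : ∀ b : HiggsLattice.PBond P j, bondVar P msq a j b ≤ σsq) {t : ℝ} (ht : 0 ≤ t) (x : HiggsLattice.Site P j) :
    (fluctMeasure P msq a j).real {A | t < ‖toSite A x‖}
      ≤ 2 * P.d * Real.exp (-(t ^ 2 / (2 * P.d * σsq))) := by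
  haveI := fluctMeasure_isProbability (P := P) hmsq ha hL hj
  have hd : (0 : ℝ) < P.d := by exact_mod_cast P.hd
  have h1 := measureReal_norm_gt_le_sum (μ := fluctMeasure P msq a j) ht (fun A => toSite A x)
  refine h1.trans ?_
  have h2 : ∀ i : Fin P.d, (fluctMeasure P msq a j).real {A | t / Real.sqrt P.d < |toSite A x i|}
      ≤ 2 * Real.exp (-(t ^ 2 / (2 * P.d * σsq))) := by
    intro i
    have h3 := measureReal_abs_apply_gt_le hmsq ha hL hj hσ0 ⟨x, i⟩ (hσ ⟨x, i⟩) (p := t / Real.sqrt P.d)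
      (div_nonneg ht (Real.sqrt_nonneg _))
    have h4 : (t / Real.sqrt P.d) ^ 2 / (2 * σsq) = t ^ 2 / (2 * P.d * σsq) := by
      rw [div_pow, Real.sq_sqrt hd.le]
      field_simp
    rw [h4] at h3
    exact h3
  calc ∑ i : Fin P.d, (fluctMeasure P msq a j).real {A | t / Real.sqrt P.d < |toSite A x i|}
      ≤ ∑ _i : Fin P.d, 2 * Real.exp (-(t ^ 2 / (2 * P.d * σsq))) := Finset.sum_le_sum fun i _ => h2 i
    _ = 2 * P.d * Real.exp (-(t ^ 2 / (2 * P.d * σsq))) := by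
        rw [Finset.sum_const, Finset.card_univ, Fintype.card_fin, nsmul_eq_mul]
        ring

/-- **`⟨χ(A′)⟩ ≥ 1 − 2d|T^{(j)}|e^{−t²/(2dσ²)}`** — the small-field probability of (3.12)/(3.43) under `dμ_{C^{(j),L^jε}}` is close to
one, by the union bound over the sites and the Gaussian tails (`μ₀² > 0`, `a > 0`, `L > 1`, `j ≤ K`; `hσ` = uniform bound on the
diagonal of the covariance; `t ≥ 0`). [cite: Balaban1982Higgs1, (3.24) p.616] -/
theorem one_sub_integral_chiFluctA_le {msq a : ℝ} (hmsq : 0 < msq) (ha : 0 < a) (hL : 1 < (P.L : ℝ)) (hj : j ≤ P.K)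
    {σsq : ℝ} (hσ0 : 0 < σsq) (hσ : ∀ b : HiggsLattice.PBond P j, bondVar P msq a j b ≤ σsq) {t : ℝ} (ht : 0 ≤ t) :
    1 - ∫ A, chiFluctA t A ∂(fluctMeasure P msq a j)
      ≤ 2 * P.d * Fintype.card (HiggsLattice.Site P j) * Real.exp (-(t ^ 2 / (2 * P.d * σsq))) := by
  haveI := fluctMeasure_isProbability (P := P) hmsq ha hL hj
  have hF : ∀ x : HiggsLattice.Site P j, Measurable fun A : HiggsLattice.VecField P j => ‖toSite A x‖ := fun x =>
    (((continuous_apply x).comp B1Eq31Concrete.continuous_toSite).norm).measurable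
  have h1 := one_sub_integral_chiFluct_le (fluctMeasure P msq a j) t hF
  unfold chiFluctA
  refine h1.trans ?_
  calc ∑ x : HiggsLattice.Site P j, (fluctMeasure P msq a j).real {A | t < ‖toSite A x‖}
      ≤ ∑ _x : HiggsLattice.Site P j, 2 * P.d * Real.exp (-(t ^ 2 / (2 * P.d * σsq))) :=
        Finset.sum_le_sum fun x _ => measureReal_norm_toSite_gt_le hmsq ha hL hj hσ0 hσ ht x
    _ = 2 * P.d * Fintype.card (HiggsLattice.Site P j) * Real.exp (-(t ^ 2 / (2 * P.d * σsq))) := by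
        rw [Finset.sum_const, Finset.card_univ, nsmul_eq_mul]
        ring

/-- **LEAF (a) FOR THE VECTOR FIELD: `|log⟨χ(A′)⟩| ≤ 4d|T^{(j)}|e^{−t²/(2dσ²)}`** as soon as `2d|T^{(j)}|e^{−t²/(2dσ²)} ≤ ½`
(`μ₀² > 0`, `a > 0`, `L > 1`, `j ≤ K`; `hσ` as above; `t ≥ 0`). [cite: Balaban1982Higgs1, (3.24) p.616] -/
theorem abs_log_integral_chiFluctA_le {msq a : ℝ} (hmsq : 0 < msq) (ha : 0 < a) (hL : 1 < (P.L : ℝ)) (hj : j ≤ P.K)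
    {σsq : ℝ} (hσ0 : 0 < σsq) (hσ : ∀ b : HiggsLattice.PBond P j, bondVar P msq a j b ≤ σsq) {t : ℝ} (ht : 0 ≤ t)
    (hsmall : 2 * P.d * Fintype.card (HiggsLattice.Site P j) * Real.exp (-(t ^ 2 / (2 * P.d * σsq))) ≤ 1 / 2) :
    |Real.log (∫ A, chiFluctA t A ∂(fluctMeasure P msq a j))|
      ≤ 4 * P.d * Fintype.card (HiggsLattice.Site P j) * Real.exp (-(t ^ 2 / (2 * P.d * σsq))) := by
  haveI := fluctMeasure_isProbability (P := P) hmsq ha hL hj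
  have hτ0 : 0 ≤ 2 * P.d * Fintype.card (HiggsLattice.Site P j) * Real.exp (-(t ^ 2 / (2 * P.d * σsq))) := by positivity
  have h1 : ∫ A, chiFluctA t A ∂(fluctMeasure P msq a j) ≤ 1 := by
    unfold chiFluctA
    exact integral_chiFluct_le_one (fluctMeasure P msq a j) t (fun A x => ‖toSite A x‖)
  have h2 := one_sub_integral_chiFluctA_le hmsq ha hL hj hσ0 hσ ht
  have h := abs_log_le_two_mul hτ0 hsmall h1 (by linarith)
  calc |Real.log (∫ A, chiFluctA t A ∂(fluctMeasure P msq a j))|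
      ≤ 2 * (2 * P.d * Fintype.card (HiggsLattice.Site P j) * Real.exp (-(t ^ 2 / (2 * P.d * σsq)))) := h
    _ = 4 * P.d * Fintype.card (HiggsLattice.Site P j) * Real.exp (-(t ^ 2 / (2 * P.d * σsq))) := by ring

/-- **LEAF (a) IN THE PRINTED SHAPE** for the vector field: if the tail total `2d|T^{(j)}|e^{−t²/(2dσ²)}` is `≤ C·s^κ·|T^{(j)}|` and `≤ ½`,
then `|log⟨χ(A′)⟩| ≤ (2C)·s^κ·|T^{(j)}|` (`s ↤ L^jε`; the hypothesis `ha` of `B1Eq324CumulantTaylor.eq324_chi`).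
[cite: Balaban1982Higgs1, (3.24) p.616] -/
theorem abs_log_integral_chiFluctA_le_pow {msq a : ℝ} (hmsq : 0 < msq) (ha : 0 < a) (hL : 1 < (P.L : ℝ)) (hj : j ≤ P.K)
    {σsq : ℝ} (hσ0 : 0 < σsq) (hσ : ∀ b : HiggsLattice.PBond P j, bondVar P msq a j b ≤ σsq) {t : ℝ} (ht : 0 ≤ t)
    (hsmall : 2 * P.d * Fintype.card (HiggsLattice.Site P j) * Real.exp (-(t ^ 2 / (2 * P.d * σsq))) ≤ 1 / 2) {C s κ : ℝ}
    (hC : 2 * P.d * Fintype.card (HiggsLattice.Site P j) * Real.exp (-(t ^ 2 / (2 * P.d * σsq))) ≤ C * s ^ κ * Fintype.card (HiggsLattice.Site P j)) :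
    |Real.log (∫ A, chiFluctA t A ∂(fluctMeasure P msq a j))| ≤ (2 * C) * s ^ κ * Fintype.card (HiggsLattice.Site P j) := by
  haveI := fluctMeasure_isProbability (P := P) hmsq ha hL hj
  have hτ0 : 0 ≤ 2 * P.d * Fintype.card (HiggsLattice.Site P j) * Real.exp (-(t ^ 2 / (2 * P.d * σsq))) := by positivity
  have h1 : ∫ A, chiFluctA t A ∂(fluctMeasure P msq a j) ≤ 1 := by
    unfold chiFluctA
    exact integral_chiFluct_le_one (fluctMeasure P msq a j) t (fun A x => ‖toSite A x‖)
  have h2 := one_sub_integral_chiFluctA_le hmsq ha hL hj hσ0 hσ ht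
  exact abs_log_le_of_tail_le_pow h1 (by linarith) hτ0 hsmall hC

end Vector

/-! ## §3 The scalar fluctuation field: `χ(φ′)` of (3.20)/(3.50) under `dμ_{C^{(k)}_Λ(Ω,A)}` -/

section Scalar

variable {P : HiggsLattice.Params} {N : ℕ} {k : ℕ}
  (C : ChargeData N) (Ω : Finset (HiggsLattice.Site P 0)) (A : HiggsLattice.VecField P 0)

/-- The test field dual to the component `φ′(y)_i` in the pairing (1.5): the vector `(L^kε)^{−d}e_i` at the site `y`, `0` elsewhere.
[cite: Balaban1982Higgs1, (1.5) p.604] -/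
def siteDelta (y : HiggsLattice.Site P k) (i : Fin N) : HiggsLattice.ScalarField P k N :=
  fun z => if z = y then (P.mesh k ^ P.d)⁻¹ • EuclideanSpace.single i (1 : ℝ) else 0

/-- `⟨siteDelta y i, φ⟩_{(1.5)} = φ(y)_i`. [cite: Balaban1982Higgs1, (1.5) p.604] -/
theorem siteInner_siteDelta (y : HiggsLattice.Site P k) (i : Fin N) (φ : HiggsLattice.ScalarField P k N) :
    siteInner (siteDelta y i) φ = φ y i := by
  have hη : P.mesh k ^ P.d ≠ 0 := (pow_pos (P.mesh_pos k) _).ne'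
  unfold siteInner
  rw [Finset.sum_eq_single y]
  · simp only [siteDelta, if_true, real_inner_smul_left, EuclideanSpace.inner_single_left, map_one, one_mul]
    field_simp
  · intro z _ hz
    simp only [siteDelta, if_neg hz, inner_zero_left, mul_zero]
  · intro hy
    exact absurd (Finset.mem_univ y) hy

variable (P) in
/-- **The variance of the component `φ′(y)_i` under `dμ_{C^{(k)}_Λ(Ω,A)}`**: `⟨siteDelta y i, C^{(k)}_Λ(Ω,A) siteDelta y i⟩_{(1.5)}` — the
diagonal of the conditional covariance (2.32) in the pairing (1.5) (bounded uniformly by the Prop. 2.3-type estimates; here a number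
that the consumer bounds). [cite: Balaban1982Higgs1, (2.32) p.611] -/
def siteVar (msq a : ℝ) (k : ℕ) (Λ : Finset (HiggsLattice.Site P k)) (y : HiggsLattice.Site P k) (i : Fin N) : ℝ :=
  siteInner (siteDelta y i) (condCov232 C Ω A msq a k Λ (siteDelta y i))

/-- The component `x ↦ (fieldOfCrd Λ x)(y)_i` is measurable in the coordinates (it is linear). [cite: Balaban1982Higgs2, (2.28) p.563] -/
theorem measurable_fieldOfCrd_apply (Λ : Finset (HiggsLattice.Site P k)) (y : HiggsLattice.Site P k) (i : Fin N) :
    Measurable fun x : In (inSet (P := P) N Λ) → ℝ => fieldOfCrd Λ x y i := by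
  have h : ∀ x : In (inSet (P := P) N Λ) → ℝ, fieldOfCrd Λ x y i = siteInner (siteDelta y i) (fieldOfCrd Λ x) := fun x =>
    (siteInner_siteDelta y i _).symm
  simp_rw [h, siteInner_fieldOfCrd]
  refine Measurable.const_mul ?_ _
  unfold dotProduct
  exact Finset.measurable_sum _ fun s _ => (measurable_pi_apply s).const_mul _

/-- The site norm `x ↦ |fieldOfCrd Λ x (y)|` is measurable in the coordinates (`|v| = √(Σᵢ vᵢ²)`). [cite: Balaban1982Higgs2, (2.28) p.563] -/
theorem measurable_norm_fieldOfCrd (Λ : Finset (HiggsLattice.Site P k)) :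
    ∀ y : HiggsLattice.Site P k, Measurable fun x : In (inSet (P := P) N Λ) → ℝ => ‖fieldOfCrd Λ x y‖ := by
  intro y
  have h : (fun x : In (inSet (P := P) N Λ) → ℝ => ‖fieldOfCrd Λ x y‖)
      = fun x => Real.sqrt (∑ i, ‖fieldOfCrd Λ x y i‖ ^ 2) := by
    funext x
    exact EuclideanSpace.norm_eq _
  rw [h]
  exact Real.continuous_sqrt.measurable.comp
    (Finset.measurable_sum _ fun i _ => ((measurable_fieldOfCrd_apply Λ y i).norm).pow_const 2)

/-- **The m.g.f. of one component**: `∫ e^{sφ′(y)_i} dμ_{C^{(k)}_Λ(Ω,A)}(φ′) = e^{s²·siteVar y i/2}` — the typer's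
`integral_exp_siteInner_condGauss` at the test field `s·siteDelta y i` (`m² > 0`, `a > 0`, `L > 1`, `k ≤ K`). [cite: Balaban1982Higgs1, (2.32) p.611] -/
theorem integral_exp_mul_apply_condGauss {msq a : ℝ} (hmsq : 0 < msq) (ha : 0 < a) (hL : 1 < (P.L : ℝ)) (hk : k ≤ P.K)
    (Λ : Finset (HiggsLattice.Site P k)) (y : HiggsLattice.Site P k) (i : Fin N) (s : ℝ) :
    ∫ x, Real.exp (s * fieldOfCrd Λ x y i) ∂(condGauss C Ω A msq a k Λ)
      = Real.exp (s ^ 2 * siteVar P C Ω A msq a k Λ y i / 2) := by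
  have h := integral_exp_siteInner_condGauss C Ω A hmsq ha hL hk Λ (s • siteDelta y i)
  have h1 : ∀ x : In (inSet (P := P) N Λ) → ℝ, siteInner (s • siteDelta y i) (fieldOfCrd Λ x) = s * fieldOfCrd Λ x y i :=
    fun x => by rw [siteInner_smul_left, siteInner_siteDelta]
  simp_rw [h1] at h
  rw [h]
  congr 1
  rw [map_smul, siteInner_smul_left, siteInner_smul_right, siteVar]
  ring

/-- **One-component tail**: `μ{p < |φ′(y)_i|} ≤ 2e^{−p²/(2σ²)}` whenever `siteVar y i ≤ σ²` (`0 < σ²`, `p ≥ 0`). [cite: Balaban1982Higgs1, (3.24) p.616] -/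
theorem measureReal_abs_fieldOfCrd_gt_le {msq a : ℝ} (hmsq : 0 < msq) (ha : 0 < a) (hL : 1 < (P.L : ℝ)) (hk : k ≤ P.K)
    (Λ : Finset (HiggsLattice.Site P k)) {σsq : ℝ} (hσ0 : 0 < σsq) (y : HiggsLattice.Site P k) (i : Fin N)
    (hσ : siteVar P C Ω A msq a k Λ y i ≤ σsq) {p : ℝ} (hp : 0 ≤ p) :
    (condGauss C Ω A msq a k Λ).real {x | p < |fieldOfCrd Λ x y i|} ≤ 2 * Real.exp (-(p ^ 2 / (2 * σsq))) := by
  haveI := isProbabilityMeasure_condGauss C Ω A hmsq ha hL hk Λ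
  exact measureReal_abs_gt_le_of_mgf hσ0 hσ (integral_exp_mul_apply_condGauss C Ω A hmsq ha hL hk Λ y i) hp

/-- **One-site tail for the `ℝ^N`-valued variable `φ′(y)`**: `μ{t < |φ′(y)|} ≤ 2N·e^{−t²/(2Nσ²)}` under the uniform variance bound
(`N ≥ 1`, `t ≥ 0`). [cite: Balaban1982Higgs1, (3.20) p.615] -/
theorem measureReal_norm_fieldOfCrd_gt_le {msq a : ℝ} (hmsq : 0 < msq) (ha : 0 < a) (hL : 1 < (P.L : ℝ)) (hk : k ≤ P.K)
    (Λ : Finset (HiggsLattice.Site P k)) (hN : 0 < N) {σsq : ℝ} (hσ0 : 0 < σsq)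
    (hσ : ∀ y i, siteVar P C Ω A msq a k Λ y i ≤ σsq) {t : ℝ} (ht : 0 ≤ t) (y : HiggsLattice.Site P k) :
    (condGauss C Ω A msq a k Λ).real {x | t < ‖fieldOfCrd Λ x y‖}
      ≤ 2 * N * Real.exp (-(t ^ 2 / (2 * N * σsq))) := by
  haveI := isProbabilityMeasure_condGauss C Ω A hmsq ha hL hk Λ
  have hN' : (0 : ℝ) < N := by exact_mod_cast hN
  have h1 := measureReal_norm_gt_le_sum (μ := condGauss C Ω A msq a k Λ) ht (fun x => fieldOfCrd Λ x y)
  refine h1.trans ?_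
  have h2 : ∀ i : Fin N, (condGauss C Ω A msq a k Λ).real {x | t / Real.sqrt N < |fieldOfCrd Λ x y i|}
      ≤ 2 * Real.exp (-(t ^ 2 / (2 * N * σsq))) := by
    intro i
    have h3 := measureReal_abs_fieldOfCrd_gt_le C Ω A hmsq ha hL hk Λ hσ0 y i (hσ y i) (p := t / Real.sqrt N)
      (div_nonneg ht (Real.sqrt_nonneg _))
    have h4 : (t / Real.sqrt N) ^ 2 / (2 * σsq) = t ^ 2 / (2 * N * σsq) := by
      rw [div_pow, Real.sq_sqrt hN'.le]
      field_simp
    rw [h4] at h3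
    exact h3
  calc ∑ i : Fin N, (condGauss C Ω A msq a k Λ).real {x | t / Real.sqrt N < |fieldOfCrd Λ x y i|}
      ≤ ∑ _i : Fin N, 2 * Real.exp (-(t ^ 2 / (2 * N * σsq))) := Finset.sum_le_sum fun i _ => h2 i
    _ = 2 * N * Real.exp (-(t ^ 2 / (2 * N * σsq))) := by
        rw [Finset.sum_const, Finset.card_univ, Fintype.card_fin, nsmul_eq_mul]
        ring

/-- **`⟨χ(φ′)⟩ ≥ 1 − 2N|T^{(k)}|e^{−t²/(2Nσ²)}`** — the small-field probability of (3.20)/(3.50) under `dμ_{C^{(k)}_Λ(Ω,A)}` (`m² > 0`,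
`a > 0`, `L > 1`, `k ≤ K`, `N ≥ 1`; `hσ` = uniform bound on the diagonal of the conditional covariance; `t ≥ 0`).
[cite: Balaban1982Higgs1, (3.24) p.616] -/
theorem one_sub_integral_chiFluctφ_le {msq a : ℝ} (hmsq : 0 < msq) (ha : 0 < a) (hL : 1 < (P.L : ℝ)) (hk : k ≤ P.K)
    (Λ : Finset (HiggsLattice.Site P k)) (hN : 0 < N) {σsq : ℝ} (hσ0 : 0 < σsq)
    (hσ : ∀ y i, siteVar P C Ω A msq a k Λ y i ≤ σsq) {t : ℝ} (ht : 0 ≤ t) :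
    1 - ∫ x, chiFluctφ t (fieldOfCrd Λ x) ∂(condGauss C Ω A msq a k Λ)
      ≤ 2 * N * Fintype.card (HiggsLattice.Site P k) * Real.exp (-(t ^ 2 / (2 * N * σsq))) := by
  haveI := isProbabilityMeasure_condGauss C Ω A hmsq ha hL hk Λ
  have h1 := one_sub_integral_chiFluct_le (condGauss C Ω A msq a k Λ) t (measurable_norm_fieldOfCrd Λ)
  unfold chiFluctφ
  refine h1.trans ?_
  calc ∑ y : HiggsLattice.Site P k, (condGauss C Ω A msq a k Λ).real {x | t < ‖fieldOfCrd Λ x y‖}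
      ≤ ∑ _y : HiggsLattice.Site P k, 2 * N * Real.exp (-(t ^ 2 / (2 * N * σsq))) :=
        Finset.sum_le_sum fun y _ => measureReal_norm_fieldOfCrd_gt_le C Ω A hmsq ha hL hk Λ hN hσ0 hσ ht y
    _ = 2 * N * Fintype.card (HiggsLattice.Site P k) * Real.exp (-(t ^ 2 / (2 * N * σsq))) := by
        rw [Finset.sum_const, Finset.card_univ, nsmul_eq_mul]
        ring

/-- **LEAF (a) FOR THE SCALAR FIELD: `|log⟨χ(φ′)⟩| ≤ 4N|T^{(k)}|e^{−t²/(2Nσ²)}`** as soon as `2N|T^{(k)}|e^{−t²/(2Nσ²)} ≤ ½`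
(`m² > 0`, `a > 0`, `L > 1`, `k ≤ K`, `N ≥ 1`; `hσ` as above; `t ≥ 0`). [cite: Balaban1982Higgs1, (3.24) p.616] -/
theorem abs_log_integral_chiFluctφ_le {msq a : ℝ} (hmsq : 0 < msq) (ha : 0 < a) (hL : 1 < (P.L : ℝ)) (hk : k ≤ P.K)
    (Λ : Finset (HiggsLattice.Site P k)) (hN : 0 < N) {σsq : ℝ} (hσ0 : 0 < σsq)
    (hσ : ∀ y i, siteVar P C Ω A msq a k Λ y i ≤ σsq) {t : ℝ} (ht : 0 ≤ t)
    (hsmall : 2 * N * Fintype.card (HiggsLattice.Site P k) * Real.exp (-(t ^ 2 / (2 * N * σsq))) ≤ 1 / 2) :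
    |Real.log (∫ x, chiFluctφ t (fieldOfCrd Λ x) ∂(condGauss C Ω A msq a k Λ))|
      ≤ 4 * N * Fintype.card (HiggsLattice.Site P k) * Real.exp (-(t ^ 2 / (2 * N * σsq))) := by
  haveI := isProbabilityMeasure_condGauss C Ω A hmsq ha hL hk Λ
  have hτ0 : 0 ≤ 2 * N * Fintype.card (HiggsLattice.Site P k) * Real.exp (-(t ^ 2 / (2 * N * σsq))) := by positivity
  have h1 : ∫ x, chiFluctφ t (fieldOfCrd Λ x) ∂(condGauss C Ω A msq a k Λ) ≤ 1 := by
    unfold chiFluctφ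
    exact integral_chiFluct_le_one (condGauss C Ω A msq a k Λ) t (fun x y => ‖fieldOfCrd Λ x y‖)
  have h2 := one_sub_integral_chiFluctφ_le C Ω A hmsq ha hL hk Λ hN hσ0 hσ ht
  have h := abs_log_le_two_mul hτ0 hsmall h1 (by linarith)
  calc |Real.log (∫ x, chiFluctφ t (fieldOfCrd Λ x) ∂(condGauss C Ω A msq a k Λ))|
      ≤ 2 * (2 * N * Fintype.card (HiggsLattice.Site P k) * Real.exp (-(t ^ 2 / (2 * N * σsq)))) := h
    _ = 4 * N * Fintype.card (HiggsLattice.Site P k) * Real.exp (-(t ^ 2 / (2 * N * σsq))) := by ring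

/-- **LEAF (a) IN THE PRINTED SHAPE** for the scalar field: if the tail total `2N|T^{(k)}|e^{−t²/(2Nσ²)}` is `≤ C·s^κ·|T^{(k)}|` and
`≤ ½`, then `|log⟨χ(φ′)⟩| ≤ (2C)·s^κ·|T^{(k)}|` (`s ↤ L^kε`; the hypothesis `ha` of `B1Eq324CumulantTaylor.eq324_chi`).
[cite: Balaban1982Higgs1, (3.59) p.623] -/
theorem abs_log_integral_chiFluctφ_le_pow {msq a : ℝ} (hmsq : 0 < msq) (ha : 0 < a) (hL : 1 < (P.L : ℝ)) (hk : k ≤ P.K)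
    (Λ : Finset (HiggsLattice.Site P k)) (hN : 0 < N) {σsq : ℝ} (hσ0 : 0 < σsq)
    (hσ : ∀ y i, siteVar P C Ω A msq a k Λ y i ≤ σsq) {t : ℝ} (ht : 0 ≤ t)
    (hsmall : 2 * N * Fintype.card (HiggsLattice.Site P k) * Real.exp (-(t ^ 2 / (2 * N * σsq))) ≤ 1 / 2) {C' s κ : ℝ}
    (hC : 2 * N * Fintype.card (HiggsLattice.Site P k) * Real.exp (-(t ^ 2 / (2 * N * σsq))) ≤ C' * s ^ κ * Fintype.card (HiggsLattice.Site P k)) :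
    |Real.log (∫ x, chiFluctφ t (fieldOfCrd Λ x) ∂(condGauss C Ω A msq a k Λ))|
      ≤ (2 * C') * s ^ κ * Fintype.card (HiggsLattice.Site P k) := by
  haveI := isProbabilityMeasure_condGauss C Ω A hmsq ha hL hk Λ
  have hτ0 : 0 ≤ 2 * N * Fintype.card (HiggsLattice.Site P k) * Real.exp (-(t ^ 2 / (2 * N * σsq))) := by positivity
  have h1 : ∫ x, chiFluctφ t (fieldOfCrd Λ x) ∂(condGauss C Ω A msq a k Λ) ≤ 1 := by
    unfold chiFluctφ
    exact integral_chiFluct_le_one (condGauss C Ω A msq a k Λ) t (fun x y => ‖fieldOfCrd Λ x y‖)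
  have h2 := one_sub_integral_chiFluctφ_le C Ω A hmsq ha hL hk Λ hN hσ0 hσ ht
  exact abs_log_le_of_tail_le_pow h1 (by linarith) hτ0 hsmall hC

end Scalar

/-! ## §4 Both factors at once: the measure `dμ_{C^{(k)}}(A′)dμ_{C^{(k)}_Λ(Ω,B)}(φ′)` of (3.24)/(3.59) -/

section Product

variable {P : HiggsLattice.Params} {N : ℕ} {k : ℕ}
  (C : ChargeData N) (Ω : Finset (HiggsLattice.Site P 0)) (B : HiggsLattice.VecField P 0)

/-- **`⟨χ(A′)χ(φ′)⟩ = ⟨χ(A′)⟩·⟨χ(φ′)⟩`** for the product measure of (3.24) p. 616 / (3.59) p. 623 (the iterated integral of r14's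
`B1Eq356FluctuationIntegral.integral356C` at `V = 0`): the `log` of the small-field probability is the SUM of the two halves, so
`|log⟨χ(A′)χ(φ′)⟩| ≤ |log⟨χ(A′)⟩| + |log⟨χ(φ′)⟩|` whenever both factors are positive. [cite: Balaban1982Higgs1, (3.24) p.616] -/
theorem abs_log_mul_le {yA yφ : ℝ} (hA : 0 < yA) (hφ : 0 < yφ) :
    |Real.log (yA * yφ)| ≤ |Real.log yA| + |Real.log yφ| := by
  rw [Real.log_mul hA.ne' hφ.ne']
  exact abs_add_le _ _

/-- **LEAF (a) OF (3.24)/(3.59) FOR THE FULL GAUSSIAN MEASURE `dμ_{C^{(k)}}(A′)dμ_{C^{(k)}_Λ(Ω,B)}(φ′)`**: with both tail totals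
`τ_A = 2d|T^{(k)}|e^{−t²/(2dσ_A²)}`, `τ_φ = 2N|T^{(k)}|e^{−t²/(2Nσ_φ²)}` at most `½`,
`|log(⟨χ(A′)⟩⟨χ(φ′)⟩)| ≤ 2τ_A + 2τ_φ` (`μ₀², m² > 0`, `a > 0`, `L > 1`, `k ≤ K`, `N ≥ 1`, `t ≥ 0`; `hσA`, `hσφ` the two displayed
covariance-diagonal bounds). [cite: Balaban1982Higgs1, (3.59) p.623] -/
theorem abs_log_integral_chi_prod_le {μ0sq msq a : ℝ} (hμ : 0 < μ0sq) (hmsq : 0 < msq) (ha : 0 < a) (hL : 1 < (P.L : ℝ))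
    (hk : k ≤ P.K) (Λ : Finset (HiggsLattice.Site P k)) (hN : 0 < N) {σA σφ : ℝ} (hσA0 : 0 < σA) (hσφ0 : 0 < σφ)
    (hσA : ∀ b : HiggsLattice.PBond P k, bondVar P μ0sq a k b ≤ σA) (hσφ : ∀ y i, siteVar P C Ω B msq a k Λ y i ≤ σφ) {t : ℝ} (ht : 0 ≤ t)
    (hsmallA : 2 * P.d * Fintype.card (HiggsLattice.Site P k) * Real.exp (-(t ^ 2 / (2 * P.d * σA))) ≤ 1 / 2)
    (hsmallφ : 2 * N * Fintype.card (HiggsLattice.Site P k) * Real.exp (-(t ^ 2 / (2 * N * σφ))) ≤ 1 / 2) :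
    |Real.log ((∫ A', chiFluctA t A' ∂(fluctMeasure P μ0sq a k))
        * ∫ x, chiFluctφ t (fieldOfCrd Λ x) ∂(condGauss C Ω B msq a k Λ))|
      ≤ 4 * P.d * Fintype.card (HiggsLattice.Site P k) * Real.exp (-(t ^ 2 / (2 * P.d * σA)))
        + 4 * N * Fintype.card (HiggsLattice.Site P k) * Real.exp (-(t ^ 2 / (2 * N * σφ))) := by
  have hA1 := one_sub_integral_chiFluctA_le (P := P) hμ ha hL hk hσA0 hσA ht
  have hφ1 := one_sub_integral_chiFluctφ_le C Ω B hmsq ha hL hk Λ hN hσφ0 hσφ ht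
  have hApos : 0 < ∫ A', chiFluctA t A' ∂(fluctMeasure P μ0sq a k) := by linarith
  have hφpos : 0 < ∫ x, chiFluctφ t (fieldOfCrd Λ x) ∂(condGauss C Ω B msq a k Λ) := by linarith
  exact (abs_log_mul_le hApos hφpos).trans (add_le_add
    (abs_log_integral_chiFluctA_le (P := P) hμ ha hL hk hσA0 hσA ht hsmallA)
    (abs_log_integral_chiFluctφ_le C Ω B hmsq ha hL hk Λ hN hσφ0 hσφ ht hsmallφ))

end Product

/-! ## §5 The printed threshold `p₁(s) = b₁(1 + log s⁻¹)^{p₁}`: the tail is `O(s^K)` for every `K` -/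

section Printed

/-- **`e^{−p₁(s)²/(2nσ²)} ≤ s^K` for `s` small** (every `K`; `b₁ > 0`, `p₁ > ½`, `n ≥ 1`, `σ² > 0`) — II p. 557 *"exp(−c₀p(ε)²) is
smaller than the arbitrary power ε^K"*, here BY NAME from p12's `B2LargeField.expPSqSmall` at `c₀ = 1/(2nσ²)`.
[cite: Balaban1982Higgs2, (2.3) p.557] -/
theorem exp_neg_pFn_sq_le_pow {n : ℕ} (hn : 0 < n) {σsq : ℝ} (hσ0 : 0 < σsq) {b₁ p₁ : ℝ} (hb : 0 < b₁) (hp : 1 / 2 < p₁)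
    (K : ℕ) : ∃ s₁ : ℝ, 0 < s₁ ∧ ∀ s : ℝ, 0 < s → s ≤ s₁ →
      Real.exp (-(B2.pFn b₁ p₁ s ^ 2 / (2 * n * σsq))) ≤ s ^ K := by
  have hn' : (0 : ℝ) < n := by exact_mod_cast hn
  obtain ⟨ε₁, hε₁, h⟩ := B2LargeField.expPSqSmall (c₀ := 1 / (2 * n * σsq)) (by positivity) hb hp K
  refine ⟨ε₁, hε₁, fun s hs hs1 => ?_⟩
  have heq : -(B2.pFn b₁ p₁ s ^ 2 / (2 * n * σsq)) = -(1 / (2 * n * σsq) * B2.pFn b₁ p₁ s ^ 2) := by ring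
  rw [heq]
  exact h s hs hs1

variable {P : HiggsLattice.Params} {j : ℕ}

/-- **LEAF (a), VECTOR FIELD, PRINTED THRESHOLD**: with `t = p₁(s) = b₁(1 + log s⁻¹)^{p₁}` ((3.12): `s = ε`; (3.43): `s = L^kε`),
`b₁ > 0`, `p₁ > ½`, for every `K` there is `s₁ > 0` such that for `0 < s ≤ s₁` and `2d|T^{(j)}|s^K ≤ ½`:
`|log⟨χ(A′)⟩| ≤ 4d|T^{(j)}|·s^K` — print's `O(ε^κ)|T₁|` with `κ = K` arbitrary (`μ₀² > 0`, `a > 0`, `L > 1`, `j ≤ K`; `hσ` the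
displayed covariance-diagonal bound). [cite: Balaban1982Higgs1, (3.24) p.616] -/
theorem abs_log_integral_chiFluctA_printed {msq a : ℝ} (hmsq : 0 < msq) (ha : 0 < a) (hL : 1 < (P.L : ℝ)) (hj : j ≤ P.K)
    {σsq : ℝ} (hσ0 : 0 < σsq) (hσ : ∀ b : HiggsLattice.PBond P j, bondVar P msq a j b ≤ σsq) {b₁ p₁ : ℝ} (hb : 0 < b₁)
    (hp : 1 / 2 < p₁) (K : ℕ) :
    ∃ s₁ : ℝ, 0 < s₁ ∧ ∀ s : ℝ, 0 < s → s ≤ s₁ →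
      2 * P.d * Fintype.card (HiggsLattice.Site P j) * s ^ K ≤ 1 / 2 →
        |Real.log (∫ A, chiFluctA (B2.pFn b₁ p₁ s) A ∂(fluctMeasure P msq a j))|
          ≤ 4 * P.d * Fintype.card (HiggsLattice.Site P j) * s ^ K := by
  obtain ⟨s₁, hs₁, h⟩ := exp_neg_pFn_sq_le_pow P.hd hσ0 hb hp K
  refine ⟨min s₁ 1, lt_min hs₁ one_pos, fun s hs hs1 hsmall => ?_⟩
  have hsε : s ≤ s₁ := hs1.trans (min_le_left _ _)
  have hs1' : s ≤ 1 := hs1.trans (min_le_right _ _)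
  have ht : 0 ≤ B2.pFn b₁ p₁ s := B1Ineq353Proof.pFn_nonneg hb.le hs hs1'
  have he := h s hs hsε
  have hvol : (0 : ℝ) ≤ 2 * P.d * Fintype.card (HiggsLattice.Site P j) := by positivity
  have htail : 2 * P.d * Fintype.card (HiggsLattice.Site P j) * Real.exp (-(B2.pFn b₁ p₁ s ^ 2 / (2 * P.d * σsq)))
      ≤ 2 * P.d * Fintype.card (HiggsLattice.Site P j) * s ^ K := mul_le_mul_of_nonneg_left he hvol
  have h1 := abs_log_integral_chiFluctA_le (P := P) hmsq ha hL hj hσ0 hσ ht (htail.trans hsmall)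
  refine h1.trans ?_
  have hvol' : (0 : ℝ) ≤ 4 * P.d * Fintype.card (HiggsLattice.Site P j) := by positivity
  calc 4 * P.d * Fintype.card (HiggsLattice.Site P j) * Real.exp (-(B2.pFn b₁ p₁ s ^ 2 / (2 * P.d * σsq)))
      ≤ 4 * P.d * Fintype.card (HiggsLattice.Site P j) * s ^ K := mul_le_mul_of_nonneg_left he hvol'

variable {N k : ℕ} (C : ChargeData N) (Ω : Finset (HiggsLattice.Site P 0)) (A : HiggsLattice.VecField P 0)

/-- **LEAF (a), SCALAR FIELD, PRINTED THRESHOLD**: with `t = p₁(s)` ((3.20): `s = ε`; (3.50): `s = L^kε`), `b₁ > 0`, `p₁ > ½`, for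
every `K` there is `s₁ > 0` such that for `0 < s ≤ s₁` and `2N|T^{(k)}|s^K ≤ ½`: `|log⟨χ(φ′)⟩| ≤ 4N|T^{(k)}|·s^K` (`m² > 0`, `a > 0`,
`L > 1`, `k ≤ K`, `N ≥ 1`; `hσ` the displayed bound on the diagonal of the conditional covariance). [cite: Balaban1982Higgs1, (3.59) p.623] -/
theorem abs_log_integral_chiFluctφ_printed {msq a : ℝ} (hmsq : 0 < msq) (ha : 0 < a) (hL : 1 < (P.L : ℝ)) (hk : k ≤ P.K)
    (Λ : Finset (HiggsLattice.Site P k)) (hN : 0 < N) {σsq : ℝ} (hσ0 : 0 < σsq)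
    (hσ : ∀ y i, siteVar P C Ω A msq a k Λ y i ≤ σsq) {b₁ p₁ : ℝ} (hb : 0 < b₁) (hp : 1 / 2 < p₁) (K : ℕ) :
    ∃ s₁ : ℝ, 0 < s₁ ∧ ∀ s : ℝ, 0 < s → s ≤ s₁ →
      2 * N * Fintype.card (HiggsLattice.Site P k) * s ^ K ≤ 1 / 2 →
        |Real.log (∫ x, chiFluctφ (B2.pFn b₁ p₁ s) (fieldOfCrd Λ x) ∂(condGauss C Ω A msq a k Λ))|
          ≤ 4 * N * Fintype.card (HiggsLattice.Site P k) * s ^ K := by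
  obtain ⟨s₁, hs₁, h⟩ := exp_neg_pFn_sq_le_pow hN hσ0 hb hp K
  refine ⟨min s₁ 1, lt_min hs₁ one_pos, fun s hs hs1 hsmall => ?_⟩
  have hsε : s ≤ s₁ := hs1.trans (min_le_left _ _)
  have hs1' : s ≤ 1 := hs1.trans (min_le_right _ _)
  have ht : 0 ≤ B2.pFn b₁ p₁ s := B1Ineq353Proof.pFn_nonneg hb.le hs hs1'
  have he := h s hs hsε
  have hvol : (0 : ℝ) ≤ 2 * N * Fintype.card (HiggsLattice.Site P k) := by positivity
  have htail : 2 * N * Fintype.card (HiggsLattice.Site P k) * Real.exp (-(B2.pFn b₁ p₁ s ^ 2 / (2 * N * σsq)))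
      ≤ 2 * N * Fintype.card (HiggsLattice.Site P k) * s ^ K := mul_le_mul_of_nonneg_left he hvol
  have h1 := abs_log_integral_chiFluctφ_le C Ω A hmsq ha hL hk Λ hN hσ0 hσ ht (htail.trans hsmall)
  refine h1.trans ?_
  have hvol' : (0 : ℝ) ≤ 4 * N * Fintype.card (HiggsLattice.Site P k) := by positivity
  exact mul_le_mul_of_nonneg_left he hvol'

end Printed

/-! ## §6 The same in the tree's `ε`-units (v1.1): threshold `(L^kε)^{−(d−2)/2}p₁(L^kε)` (`B1Eq31Concrete.thrF`), variance `σ₁²(L^kε)^{−(d−2)}` -/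

section TreeUnits

open B1Eq31Concrete (thrF)

/-- **Scale bookkeeping**: with the threshold of the tree's conventions `t = s^{−(d−2)/2}·p` (`thrF d s p`, the (1.22) rescaling
of print's unit-lattice threshold `p`) and a variance bound of the matching size `σ² = σ₁²·s^{−(d−2)}`, the Gaussian exponent is
scale free: `t²/(2nσ²) = p²/(2nσ₁²)` (`s > 0`). [cite: Balaban1982Higgs1, (1.22) p.607] -/
theorem thrF_sq_div (d n : ℕ) {s : ℝ} (hs : 0 < s) (p σ1sq : ℝ) :
    thrF d s p ^ 2 / (2 * n * (σ1sq * s ^ (-((d : ℝ) - 2)))) = p ^ 2 / (2 * n * σ1sq) := by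
  have hpow : (s ^ (-(((d : ℝ) - 2) / 2))) ^ 2 = s ^ (-((d : ℝ) - 2)) := by
    rw [← Real.rpow_natCast, ← Real.rpow_mul hs.le]
    congr 1
    push_cast
    ring
  have hne : s ^ (-((d : ℝ) - 2)) ≠ 0 := (Real.rpow_pos_of_pos hs _).ne'
  unfold thrF
  rw [mul_pow, hpow]
  field_simp

variable {P : HiggsLattice.Params} {j : ℕ}

/-- **LEAF (a), VECTOR FIELD, IN THE TREE'S `ε`-UNITS**: `χ(A′)` with the threshold `(L^jε)^{−(d−2)/2}p₁(L^jε)` of r14's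
`B1Eq343FluctuationChi` docstring (`thrF d (L^jε) (p₁(L^jε))`, `p₁ = B2.pFn b₁ p₁`), the variance bound in the matching units
`bondVar b ≤ σ₁²(L^jε)^{−(d−2)}` (`σ₁²` = the scale-free, Prop. 2.3-type constant), and the scale-free smallness
`e^{−p₁(L^jε)²/(2dσ₁²)} ≤ (L^jε)^K` (supplied by `exp_neg_pFn_sq_le_pow` once `L^jε ≤ s₁(K)`): if moreover `2d|T^{(j)}|(L^jε)^K ≤ ½`
then `|log⟨χ(A′)⟩| ≤ 4d|T^{(j)}|(L^jε)^K` (`μ₀² > 0`, `a > 0`, `L > 1`, `j ≤ K`, `L^jε ≤ 1`, `b₁ > 0`). [cite: Balaban1982Higgs1, (3.24) p.616] -/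
theorem abs_log_integral_chiFluctA_thrF {msq a : ℝ} (hmsq : 0 < msq) (ha : 0 < a) (hL : 1 < (P.L : ℝ)) (hj : j ≤ P.K)
    {σ1sq : ℝ} (hσ0 : 0 < σ1sq)
    (hσ : ∀ b : HiggsLattice.PBond P j, bondVar P msq a j b ≤ σ1sq * P.mesh j ^ (-((P.d : ℝ) - 2)))
    {b₁ p₁ : ℝ} (hb : 0 < b₁) (hmesh1 : P.mesh j ≤ 1) {K : ℕ}
    (hexp : Real.exp (-(B2.pFn b₁ p₁ (P.mesh j) ^ 2 / (2 * P.d * σ1sq))) ≤ P.mesh j ^ K)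
    (hsmall : 2 * P.d * Fintype.card (HiggsLattice.Site P j) * P.mesh j ^ K ≤ 1 / 2) :
    |Real.log (∫ A, chiFluctA (thrF P.d (P.mesh j) (B2.pFn b₁ p₁ (P.mesh j))) A ∂(fluctMeasure P msq a j))|
      ≤ 4 * P.d * Fintype.card (HiggsLattice.Site P j) * P.mesh j ^ K := by
  have hs : 0 < P.mesh j := P.mesh_pos j
  have hσ0' : 0 < σ1sq * P.mesh j ^ (-((P.d : ℝ) - 2)) := mul_pos hσ0 (Real.rpow_pos_of_pos hs _)
  have hp0 : 0 ≤ B2.pFn b₁ p₁ (P.mesh j) := B1Ineq353Proof.pFn_nonneg hb.le hs hmesh1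
  have ht : 0 ≤ thrF P.d (P.mesh j) (B2.pFn b₁ p₁ (P.mesh j)) := by
    unfold thrF
    exact mul_nonneg (Real.rpow_nonneg hs.le _) hp0
  have hkey : thrF P.d (P.mesh j) (B2.pFn b₁ p₁ (P.mesh j)) ^ 2 / (2 * P.d * (σ1sq * P.mesh j ^ (-((P.d : ℝ) - 2))))
      = B2.pFn b₁ p₁ (P.mesh j) ^ 2 / (2 * P.d * σ1sq) := thrF_sq_div P.d P.d hs _ _
  have hvol : (0 : ℝ) ≤ 2 * P.d * Fintype.card (HiggsLattice.Site P j) := by positivity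
  have htail : 2 * P.d * Fintype.card (HiggsLattice.Site P j)
        * Real.exp (-(thrF P.d (P.mesh j) (B2.pFn b₁ p₁ (P.mesh j)) ^ 2 / (2 * P.d * (σ1sq * P.mesh j ^ (-((P.d : ℝ) - 2))))))
      ≤ 2 * P.d * Fintype.card (HiggsLattice.Site P j) * P.mesh j ^ K := by
    rw [hkey]
    exact mul_le_mul_of_nonneg_left hexp hvol
  have h1 := abs_log_integral_chiFluctA_le (P := P) hmsq ha hL hj hσ0' hσ ht (htail.trans hsmall)
  refine h1.trans ?_
  rw [hkey]
  have hvol' : (0 : ℝ) ≤ 4 * P.d * Fintype.card (HiggsLattice.Site P j) := by positivity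
  exact mul_le_mul_of_nonneg_left hexp hvol'

variable {N k : ℕ} (C : ChargeData N) (Ω : Finset (HiggsLattice.Site P 0)) (A : HiggsLattice.VecField P 0)

/-- **LEAF (a), SCALAR FIELD, IN THE TREE'S `ε`-UNITS**: the same for `χ(φ′)` with threshold `thrF d (L^kε) (p₁(L^kε))` under
`dμ_{C^{(k)}_Λ(Ω,A)}`, variance bound `siteVar y i ≤ σ₁²(L^kε)^{−(d−2)}` (`m² > 0`, `a > 0`, `L > 1`, `k ≤ K`, `N ≥ 1`, `L^kε ≤ 1`,
`b₁ > 0`). [cite: Balaban1982Higgs1, (3.59) p.623] -/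
theorem abs_log_integral_chiFluctφ_thrF {msq a : ℝ} (hmsq : 0 < msq) (ha : 0 < a) (hL : 1 < (P.L : ℝ)) (hk : k ≤ P.K)
    (Λ : Finset (HiggsLattice.Site P k)) (hN : 0 < N) {σ1sq : ℝ} (hσ0 : 0 < σ1sq)
    (hσ : ∀ y i, siteVar P C Ω A msq a k Λ y i ≤ σ1sq * P.mesh k ^ (-((P.d : ℝ) - 2)))
    {b₁ p₁ : ℝ} (hb : 0 < b₁) (hmesh1 : P.mesh k ≤ 1) {K : ℕ}
    (hexp : Real.exp (-(B2.pFn b₁ p₁ (P.mesh k) ^ 2 / (2 * N * σ1sq))) ≤ P.mesh k ^ K)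
    (hsmall : 2 * N * Fintype.card (HiggsLattice.Site P k) * P.mesh k ^ K ≤ 1 / 2) :
    |Real.log (∫ x, chiFluctφ (thrF P.d (P.mesh k) (B2.pFn b₁ p₁ (P.mesh k))) (fieldOfCrd Λ x)
        ∂(condGauss C Ω A msq a k Λ))|
      ≤ 4 * N * Fintype.card (HiggsLattice.Site P k) * P.mesh k ^ K := by
  have hs : 0 < P.mesh k := P.mesh_pos k
  have hσ0' : 0 < σ1sq * P.mesh k ^ (-((P.d : ℝ) - 2)) := mul_pos hσ0 (Real.rpow_pos_of_pos hs _)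
  have hp0 : 0 ≤ B2.pFn b₁ p₁ (P.mesh k) := B1Ineq353Proof.pFn_nonneg hb.le hs hmesh1
  have ht : 0 ≤ thrF P.d (P.mesh k) (B2.pFn b₁ p₁ (P.mesh k)) := by
    unfold thrF
    exact mul_nonneg (Real.rpow_nonneg hs.le _) hp0
  have hkey : thrF P.d (P.mesh k) (B2.pFn b₁ p₁ (P.mesh k)) ^ 2 / (2 * N * (σ1sq * P.mesh k ^ (-((P.d : ℝ) - 2))))
      = B2.pFn b₁ p₁ (P.mesh k) ^ 2 / (2 * N * σ1sq) := thrF_sq_div P.d N hs _ _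
  have hvol : (0 : ℝ) ≤ 2 * N * Fintype.card (HiggsLattice.Site P k) := by positivity
  have htail : 2 * N * Fintype.card (HiggsLattice.Site P k)
        * Real.exp (-(thrF P.d (P.mesh k) (B2.pFn b₁ p₁ (P.mesh k)) ^ 2 / (2 * N * (σ1sq * P.mesh k ^ (-((P.d : ℝ) - 2))))))
      ≤ 2 * N * Fintype.card (HiggsLattice.Site P k) * P.mesh k ^ K := by
    rw [hkey]
    exact mul_le_mul_of_nonneg_left hexp hvol
  have h1 := abs_log_integral_chiFluctφ_le C Ω A hmsq ha hL hk Λ hN hσ0' hσ ht (htail.trans hsmall)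
  refine h1.trans ?_
  rw [hkey]
  have hvol' : (0 : ℝ) ≤ 4 * N * Fintype.card (HiggsLattice.Site P k) := by positivity
  exact mul_le_mul_of_nonneg_left hexp hvol'

end TreeUnits

/-! ## §7 (v1.1) Positivity of the small-field probabilities — the hypothesis `⟨χ⟩ > 0` of p27's `eq324_chi` / `Realization.χ_pos` -/

section Positivity

variable {P : HiggsLattice.Params} {j : ℕ}

/-- `⟨χ(A′)⟩ ≥ ½ > 0` once the tail total `2d|T^{(j)}|e^{−t²/(2dσ²)} ≤ ½` — the hypothesis `hpos : 0 < ∫χ dμ` of p27's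
`B1Eq324CumulantTaylor.eq324_chi` (field `χ_pos` of `Realization`) for the vector factor. [cite: Balaban1982Higgs1, (3.24) p.616] -/
theorem integral_chiFluctA_pos {msq a : ℝ} (hmsq : 0 < msq) (ha : 0 < a) (hL : 1 < (P.L : ℝ)) (hj : j ≤ P.K)
    {σsq : ℝ} (hσ0 : 0 < σsq) (hσ : ∀ b : HiggsLattice.PBond P j, bondVar P msq a j b ≤ σsq) {t : ℝ} (ht : 0 ≤ t)
    (hsmall : 2 * P.d * Fintype.card (HiggsLattice.Site P j) * Real.exp (-(t ^ 2 / (2 * P.d * σsq))) ≤ 1 / 2) :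
    0 < ∫ A, chiFluctA t A ∂(fluctMeasure P msq a j) := by
  have h := one_sub_integral_chiFluctA_le (P := P) hmsq ha hL hj hσ0 hσ ht
  linarith

variable {N k : ℕ} (C : ChargeData N) (Ω : Finset (HiggsLattice.Site P 0)) (A : HiggsLattice.VecField P 0)

/-- `⟨χ(φ′)⟩ ≥ ½ > 0` once the tail total `2N|T^{(k)}|e^{−t²/(2Nσ²)} ≤ ½` (the scalar factor). [cite: Balaban1982Higgs1, (3.24) p.616] -/
theorem integral_chiFluctφ_pos {msq a : ℝ} (hmsq : 0 < msq) (ha : 0 < a) (hL : 1 < (P.L : ℝ)) (hk : k ≤ P.K)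
    (Λ : Finset (HiggsLattice.Site P k)) (hN : 0 < N) {σsq : ℝ} (hσ0 : 0 < σsq)
    (hσ : ∀ y i, siteVar P C Ω A msq a k Λ y i ≤ σsq) {t : ℝ} (ht : 0 ≤ t)
    (hsmall : 2 * N * Fintype.card (HiggsLattice.Site P k) * Real.exp (-(t ^ 2 / (2 * N * σsq))) ≤ 1 / 2) :
    0 < ∫ x, chiFluctφ t (fieldOfCrd Λ x) ∂(condGauss C Ω A msq a k Λ) := by
  have h := one_sub_integral_chiFluctφ_le C Ω A hmsq ha hL hk Λ hN hσ0 hσ ht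
  linarith

/-- **`⟨χ(A′)χ(φ′)⟩ > 0` for the product measure of (3.24)/(3.59)** (= r14's `integral356C … (V = 0)` by
`B1Eq356FluctuationIntegral.integral356C_zero`), both tails `≤ ½`. [cite: Balaban1982Higgs1, (3.56) p.622] -/
theorem integral_chi_prod_pos {μ0sq msq a : ℝ} (hμ : 0 < μ0sq) (hmsq : 0 < msq) (ha : 0 < a) (hL : 1 < (P.L : ℝ))
    (hk : k ≤ P.K) (Λ : Finset (HiggsLattice.Site P k)) (hN : 0 < N) {σA σφ : ℝ} (hσA0 : 0 < σA) (hσφ0 : 0 < σφ)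
    (hσA : ∀ b : HiggsLattice.PBond P k, bondVar P μ0sq a k b ≤ σA) (hσφ : ∀ y i, siteVar P C Ω A msq a k Λ y i ≤ σφ)
    {t : ℝ} (ht : 0 ≤ t)
    (hsmallA : 2 * P.d * Fintype.card (HiggsLattice.Site P k) * Real.exp (-(t ^ 2 / (2 * P.d * σA))) ≤ 1 / 2)
    (hsmallφ : 2 * N * Fintype.card (HiggsLattice.Site P k) * Real.exp (-(t ^ 2 / (2 * N * σφ))) ≤ 1 / 2) :
    0 < (∫ A', chiFluctA t A' ∂(fluctMeasure P μ0sq a k))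
        * ∫ x, chiFluctφ t (fieldOfCrd Λ x) ∂(condGauss C Ω A msq a k Λ) :=
  mul_pos (integral_chiFluctA_pos (P := P) hμ ha hL hk hσA0 hσA ht hsmallA)
    (integral_chiFluctφ_pos C Ω A hmsq ha hL hk Λ hN hσφ0 hσφ ht hsmallφ)

end Positivity

/-! ## §8 (v1.1) The displayed variance bound FROM the printed (2.33) lower half `γ₀I ≤ aL⁻²P + Δ^{(k)}` (vector field) -/

section FromIneq233

variable {P : HiggsLattice.Params} {j : ℕ}

open HiggsCovarianceCont (sNorm)
open HiggsFluctMeasurePos (siteInner_le_sNorm_mul precOp_mul_fluctCov)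
open HiggsCovariancePos (siteInner_self_nonneg)

/-- **A coercive operator has a bounded inverse in the quadratic-form sense**: if `c⟨f,f⟩ ≤ ⟨f,(C^{(j)})⁻¹f⟩` for all `f`
(`c > 0`), then `⟨g, C^{(j)}g⟩ ≤ c⁻¹⟨g,g⟩` for all `g` (`μ₀² > 0`, `a > 0`, `L > 1`, `j ≤ K`, so that `C^{(j)}` is the two-sided
inverse of the operator of (2.30)). [cite: Balaban1982Higgs1, (2.33) p.611] -/
theorem siteInner_fluctCov_self_le {msq a : ℝ} (hmsq : 0 < msq) (ha : 0 < a) (hL : 1 < (P.L : ℝ)) (hj : j ≤ P.K)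
    {c : ℝ} (hc : 0 < c)
    (hco : ∀ f : HiggsLattice.ScalarField P j P.d, c * siteInner f f ≤ siteInner f (precOp P msq a j f))
    (g : HiggsLattice.ScalarField P j P.d) :
    siteInner g (fluctCov P msq a j g) ≤ c⁻¹ * siteInner g g := by
  set f := fluctCov P msq a j g with hf
  have hMf : precOp P msq a j f = g := by
    have h := congrArg (fun T : Module.End ℝ (HiggsLattice.ScalarField P j P.d) => T g) (precOp_mul_fluctCov (P := P) hmsq ha hL hj)
    simpa [Module.End.mul_apply] using h
  have hX : siteInner g f = siteInner f (precOp P msq a j f) := by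
    rw [hMf, siteInner_comm]
  have h1 : c * siteInner f f ≤ siteInner g f := by rw [hX]; exact hco f
  have hCS : siteInner g f ≤ sNorm g * sNorm f := siteInner_le_sNorm_mul g f
  have hgg : 0 ≤ siteInner g g := siteInner_self_nonneg g
  have hff : 0 ≤ siteInner f f := siteInner_self_nonneg f
  have hsg : sNorm g ^ 2 = siteInner g g := Real.sq_sqrt hgg
  have hsf : sNorm f ^ 2 = siteInner f f := Real.sq_sqrt hff
  have hsg0 : 0 ≤ sNorm g := Real.sqrt_nonneg _
  have hsf0 : 0 ≤ sNorm f := Real.sqrt_nonneg _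
  -- `c·|f|² ≤ |g||f|`, hence `c·|f| ≤ |g|` or `|f| = 0`; in both cases `⟨g,f⟩ ≤ |g||f| ≤ |g|²/c`
  have h2 : c * sNorm f ≤ sNorm g ∨ sNorm f = 0 := by
    by_cases h0 : sNorm f = 0
    · exact Or.inr h0
    · left
      have hpos : 0 < sNorm f := lt_of_le_of_ne hsf0 (Ne.symm h0)
      have h3 : c * sNorm f ^ 2 ≤ sNorm g * sNorm f := by rw [hsf]; exact h1.trans hCS
      nlinarith
  have h4 : sNorm g * sNorm f ≤ c⁻¹ * siteInner g g := by
    rw [← hsg]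
    rcases h2 with h2 | h2
    · have : sNorm f ≤ c⁻¹ * sNorm g := by
        rw [le_inv_mul_iff₀ hc]
        exact h2
      nlinarith
    · rw [h2, mul_zero]
      positivity
  exact hCS.trans h4

/-- `⟨toSite(bondDelta b), toSite(bondDelta b)⟩_{(1.5)} = (L^jε)^{−d}`. [cite: Balaban1982Higgs1, (1.5) p.604] -/
theorem siteInner_bondDelta_self (b : HiggsLattice.PBond P j) :
    siteInner (toSite (bondDelta b)) (toSite (bondDelta b)) = (P.mesh j ^ P.d)⁻¹ := by
  rw [siteInner_bondDelta]
  simp [bondDelta]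

/-- **THE VARIANCE BOUND FROM THE (2.33) LOWER HALF**, in the level form of the tree (`γ₀(L^jε)^{−2}‖f‖² ≤ ⟨f,(a(L^{j+1}ε)^{−2}P +
Δ^{(j)})f⟩`, cf. the upper-half level forms of r14's `B1Ineq233Upper`): `bondVar b ≤ γ₀⁻¹·(L^jε)²·(L^jε)^{−d}` for every bond —
i.e. the displayed input `hσ` of §2/§6 with `σ₁² = γ₀⁻¹` IS print's Prop. 2.3 (2.33) lower bound (`μ₀² > 0`, `a > 0`, `L > 1`, `j ≤ K`).
[cite: Balaban1982Higgs1, (2.33) p.611] -/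
theorem bondVar_le_of_ineq233_lower {msq a : ℝ} (hmsq : 0 < msq) (ha : 0 < a) (hL : 1 < (P.L : ℝ)) (hj : j ≤ P.K)
    {γ₀ : ℝ} (hγ : 0 < γ₀)
    (h233 : ∀ f : HiggsLattice.ScalarField P j P.d,
      γ₀ * (P.mesh j)⁻¹ ^ 2 * siteInner f f ≤ siteInner f (precOp P msq a j f))
    (b : HiggsLattice.PBond P j) :
    bondVar P msq a j b ≤ γ₀⁻¹ * P.mesh j ^ 2 * (P.mesh j ^ P.d)⁻¹ := by
  have hs : 0 < P.mesh j := P.mesh_pos j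
  have hc : 0 < γ₀ * (P.mesh j)⁻¹ ^ 2 := by positivity
  have h := siteInner_fluctCov_self_le (P := P) hmsq ha hL hj hc h233 (toSite (bondDelta b))
  rw [siteInner_bondDelta_self] at h
  unfold bondVar
  refine h.trans (le_of_eq ?_)
  rw [mul_inv, inv_pow, inv_inv]

/-- The same bound written with the real power of §6: `γ₀⁻¹(L^jε)²(L^jε)^{−d} = γ₀⁻¹(L^jε)^{−(d−2)}`. [cite: Balaban1982Higgs1, (2.33) p.611] -/
theorem bondVar_le_of_ineq233_lower' {msq a : ℝ} (hmsq : 0 < msq) (ha : 0 < a) (hL : 1 < (P.L : ℝ)) (hj : j ≤ P.K)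
    {γ₀ : ℝ} (hγ : 0 < γ₀)
    (h233 : ∀ f : HiggsLattice.ScalarField P j P.d,
      γ₀ * (P.mesh j)⁻¹ ^ 2 * siteInner f f ≤ siteInner f (precOp P msq a j f))
    (b : HiggsLattice.PBond P j) :
    bondVar P msq a j b ≤ γ₀⁻¹ * P.mesh j ^ (-((P.d : ℝ) - 2)) := by
  have hs : 0 < P.mesh j := P.mesh_pos j
  have h := bondVar_le_of_ineq233_lower (P := P) hmsq ha hL hj hγ h233 b
  have hpow : P.mesh j ^ 2 * (P.mesh j ^ P.d)⁻¹ = P.mesh j ^ (-((P.d : ℝ) - 2)) := by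
    rw [← Real.rpow_natCast (P.mesh j) P.d, ← Real.rpow_neg hs.le, ← Real.rpow_natCast (P.mesh j) 2,
      ← Real.rpow_add hs]
    congr 1
    push_cast
    ring
  rw [mul_assoc, hpow] at h
  exact h

end FromIneq233

/-! ## §9 (v1.1) The same for the scalar conditional covariance (2.32): `siteVar` from the (2.33) lower half for `aL⁻²P(A) + Δ^{(k)}(Ω,A)` -/

section FromIneq233Scalar

variable {P : HiggsLattice.Params} {N k : ℕ}
  (C : ChargeData N) (Ω : Finset (HiggsLattice.Site P 0)) (A : HiggsLattice.VecField P 0)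

open HiggsCovarianceCont (sNorm)
open HiggsFluctMeasurePos (siteInner_le_sNorm_mul)
open HiggsCovariancePos (siteInner_self_nonneg)
open HiggsCondCov232 (restrictOp restrictOp_precOpA_condCov232_apply condCov232_apply_of_not_mem siteInner_restrictOp
  siteInner_cutTo_comm)
open B2Eq255Concrete (cutTo cutTo_of_mem cutTo_of_not_mem)
open B1Eq230FluctCov (precOpA)

/-- The Cauchy–Schwarz endgame: `c·|f|² ≤ X ≤ |g|·|f|` with `c > 0` forces `X ≤ c⁻¹|g|²`. [folklore] -/
private theorem le_inv_mul_sq_of_coercive {c X sf sg : ℝ} (hc : 0 < c) (hsf : 0 ≤ sf) (hsg : 0 ≤ sg)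
    (h1 : c * sf ^ 2 ≤ X) (h2 : X ≤ sg * sf) : X ≤ c⁻¹ * sg ^ 2 := by
  by_cases h0 : sf = 0
  · rw [h0, mul_zero] at h2
    exact h2.trans (by positivity)
  · have hpos : 0 < sf := lt_of_le_of_ne hsf (Ne.symm h0)
    have h3 : c * sf ≤ sg := by nlinarith
    have h4 : sf ≤ c⁻¹ * sg := by rw [le_inv_mul_iff₀ hc]; exact h3
    nlinarith

/-- `C^{(k)}_Λ(Ω,A)g` is supported in `Λ`: `Λ(C^{(k)}_Λ g) = C^{(k)}_Λ g`. [cite: Balaban1982Higgs1, (2.32) p.611] -/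
theorem cutTo_condCov232 {msq a : ℝ} (Λ : Finset (HiggsLattice.Site P k)) (g : HiggsLattice.ScalarField P k N) :
    cutTo Λ (condCov232 C Ω A msq a k Λ g) = condCov232 C Ω A msq a k Λ g := by
  funext x
  by_cases hx : x ∈ Λ
  · rw [cutTo_of_mem Λ _ hx]
  · rw [cutTo_of_not_mem Λ _ hx, condCov232_apply_of_not_mem C Ω A msq a k Λ g hx]

/-- **A coercive operator has a form-bounded CONDITIONAL inverse**: if `c⟨f,f⟩ ≤ ⟨f,(a(L^{k+1}ε)^{−2}P(A) + Δ^{(k)}(Ω,A))f⟩` for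
all `f` (`c > 0`), then `⟨g, C^{(k)}_Λ(Ω,A)g⟩ ≤ c⁻¹⟨g,g⟩` for every `Λ` and `g` (`m² > 0`, `a > 0`, `L > 1`, `k ≤ K`, so that
`((…)↾_Λ)·C^{(k)}_Λ = Λ`, the typer's `restrictOp_precOpA_condCov232_apply`). [cite: Balaban1982Higgs1, (2.32) p.611] -/
theorem siteInner_condCov232_self_le {msq a : ℝ} (hmsq : 0 < msq) (ha : 0 < a) (hL : 1 < (P.L : ℝ)) (hk : k ≤ P.K)
    (Λ : Finset (HiggsLattice.Site P k)) {c : ℝ} (hc : 0 < c)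
    (hco : ∀ f : HiggsLattice.ScalarField P k N, c * siteInner f f ≤ siteInner f (precOpA C Ω A msq a k f))
    (g : HiggsLattice.ScalarField P k N) :
    siteInner g (condCov232 C Ω A msq a k Λ g) ≤ c⁻¹ * siteInner g g := by
  set f := condCov232 C Ω A msq a k Λ g with hf
  have hsupp : cutTo Λ f = f := cutTo_condCov232 C Ω A Λ g
  have hR : restrictOp Λ (precOpA C Ω A msq a k) f = cutTo Λ g :=
    restrictOp_precOpA_condCov232_apply C Ω A hmsq ha hL hk Λ g
  -- `X := ⟨g, C_Λ g⟩ = ⟨f, (…)↾_Λ f⟩ = ⟨f, (…) f⟩`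
  have hX1 : siteInner f (restrictOp Λ (precOpA C Ω A msq a k) f) = siteInner f (precOpA C Ω A msq a k f) := by
    rw [siteInner_restrictOp, hsupp]
  have hX2 : siteInner f (restrictOp Λ (precOpA C Ω A msq a k) f) = siteInner g f := by
    rw [hR, siteInner_cutTo_comm, hsupp]
  have hsf : sNorm f ^ 2 = siteInner f f := Real.sq_sqrt (siteInner_self_nonneg f)
  have hsg : sNorm g ^ 2 = siteInner g g := Real.sq_sqrt (siteInner_self_nonneg g)
  have h1 : c * sNorm f ^ 2 ≤ siteInner g f := by
    rw [hsf, ← hX2, hX1]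
    exact hco f
  have h2 : siteInner g f ≤ sNorm g * sNorm f := siteInner_le_sNorm_mul g f
  have hsf0 : 0 ≤ sNorm f := Real.sqrt_nonneg _
  have hsg0 : 0 ≤ sNorm g := Real.sqrt_nonneg _
  have h := le_inv_mul_sq_of_coercive hc hsf0 hsg0 h1 h2
  rwa [hsg] at h

/-- `⟨siteDelta y i, siteDelta y i⟩_{(1.5)} = (L^kε)^{−d}`. [cite: Balaban1982Higgs1, (1.5) p.604] -/
theorem siteInner_siteDelta_self (y : HiggsLattice.Site P k) (i : Fin N) :
    siteInner (siteDelta (P := P) y i) (siteDelta y i) = (P.mesh k ^ P.d)⁻¹ := by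
  rw [siteInner_siteDelta]
  simp [siteDelta]

/-- **THE VARIANCE BOUND FOR `φ′(y)_i` FROM THE (2.33) LOWER HALF** (level form `γ₀(L^kε)^{−2}‖f‖² ≤ ⟨f,(a(L^{k+1}ε)^{−2}P(A) +
Δ^{(k)}(Ω,A))f⟩`, general background `A` and region `Ω` — Prop. 2.3 as printed, an INPUT): `siteVar y i ≤ γ₀⁻¹(L^kε)²(L^kε)^{−d}`
for every conditioning set `Λ`, site and component — the displayed input `hσ` of §3/§6 with `σ₁² = γ₀⁻¹` (`m² > 0`, `a > 0`,
`L > 1`, `k ≤ K`). [cite: Balaban1982Higgs1, (2.33) p.611] -/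
theorem siteVar_le_of_ineq233_lower {msq a : ℝ} (hmsq : 0 < msq) (ha : 0 < a) (hL : 1 < (P.L : ℝ)) (hk : k ≤ P.K)
    (Λ : Finset (HiggsLattice.Site P k)) {γ₀ : ℝ} (hγ : 0 < γ₀)
    (h233 : ∀ f : HiggsLattice.ScalarField P k N,
      γ₀ * (P.mesh k)⁻¹ ^ 2 * siteInner f f ≤ siteInner f (precOpA C Ω A msq a k f))
    (y : HiggsLattice.Site P k) (i : Fin N) :
    siteVar P C Ω A msq a k Λ y i ≤ γ₀⁻¹ * P.mesh k ^ 2 * (P.mesh k ^ P.d)⁻¹ := by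
  have hs : 0 < P.mesh k := P.mesh_pos k
  have hc : 0 < γ₀ * (P.mesh k)⁻¹ ^ 2 := by positivity
  have h := siteInner_condCov232_self_le C Ω A hmsq ha hL hk Λ hc h233 (siteDelta y i)
  rw [siteInner_siteDelta_self] at h
  unfold siteVar
  refine h.trans (le_of_eq ?_)
  rw [mul_inv, inv_pow, inv_inv]

/-- The same with the real power of §6: `siteVar y i ≤ γ₀⁻¹(L^kε)^{−(d−2)}`. [cite: Balaban1982Higgs1, (2.33) p.611] -/
theorem siteVar_le_of_ineq233_lower' {msq a : ℝ} (hmsq : 0 < msq) (ha : 0 < a) (hL : 1 < (P.L : ℝ)) (hk : k ≤ P.K)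
    (Λ : Finset (HiggsLattice.Site P k)) {γ₀ : ℝ} (hγ : 0 < γ₀)
    (h233 : ∀ f : HiggsLattice.ScalarField P k N,
      γ₀ * (P.mesh k)⁻¹ ^ 2 * siteInner f f ≤ siteInner f (precOpA C Ω A msq a k f))
    (y : HiggsLattice.Site P k) (i : Fin N) :
    siteVar P C Ω A msq a k Λ y i ≤ γ₀⁻¹ * P.mesh k ^ (-((P.d : ℝ) - 2)) := by
  have hs : 0 < P.mesh k := P.mesh_pos k
  have h := siteVar_le_of_ineq233_lower C Ω A hmsq ha hL hk Λ hγ h233 y i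
  have hpow : P.mesh k ^ 2 * (P.mesh k ^ P.d)⁻¹ = P.mesh k ^ (-((P.d : ℝ) - 2)) := by
    rw [← Real.rpow_natCast (P.mesh k) P.d, ← Real.rpow_neg hs.le, ← Real.rpow_natCast (P.mesh k) 2,
      ← Real.rpow_add hs]
    congr 1
    push_cast
    ring
  rw [mul_assoc, hpow] at h
  exact h

end FromIneq233Scalar

end

end Literature.MathematicalPhysics.QuantumFieldTheory.Balaban1983to89.B1Eq324SmallFieldLeaf
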